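import Summits.CriticalPhenomena.SAWScalingLimit.Theses.SAWDefectDecoherence
import Literature.Probability.RandomPlanarGeometry.HexSAWLattice
import Literature.Probability.RandomPlanarGeometry.HexParafermionProofs
import Literature.Probability.RandomPlanarGeometry.RectangleConformalMap
import Literature.Probability.RandomPlanarGeometry.HexSAWTheorem1

/-!
# Negative-side results for the crux `SAWDefectDecoherence.MassRatio` (stmt-CriticalPhenomena-8550):
the EXHAUSTION clause of its frame is load-bearing — for the crux and for the line stub
`stub_localL1Bound` (line `coherence-floor-rh-harnack`)

Refuter `drefute` seat `refuter-drefute-stmt-CriticalPhenomena-8550-0` (mutation analysis of the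
picked line's stubs). Main theorems (all `sorry`-free):

* `massRatio_false_without_exhaustion : ¬ MassRatioWithoutExhaustion` — `MassRatio` with the
  conjunct `∀ K compact ⊆ Ω, ∀ᶠ δ, ∀ v, δ·c_v ∈ K → v ∈ Λ_δ` deleted (flatness at `b`, rows clause,
  simple connectivity, connectedness, inside `Ω`, boundary mid-edges, `Nonempty`, `δ·mid a_δ → a`,
  `δ·mid b_δ → b` all KEPT) is FALSE;
* `localL1Bound_false_without_exhaustion : ¬ LocalL1BoundWithoutExhaustion (3/4)` and
  `not_forall_localL1BoundWithoutExhaustion` — the same deletion kills the stub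
  `stub_localL1Bound` (`∀ s > 0, LocalL1Bound s`) of the line skeleton, already at `s = 3/4`.

Witness (§N3–§N6): in the marked rectangle `D₀ = (-2,2)×(-1,1)` (`a = -1-i`, `b = 1-i`, flat at
`b`, `ρ = 1`), the family `Λfam δ = H ∪ Γ`: the block `H` = rows `m … MT` (`y ∈ (-1, 0.3)`) over
positions `-2 … P` (`x ∈ (-δ/2, 2)`), which contains the half-lattice of the unit ball at `b` (rows
clause), and a bare CORRIDOR `Γ = (cor δ j)_{j ≤ J}`: an up-right staircase from the root vertex
`(m, pA)` to the apex row `RA` (`y ≈ 0.9`), then a down-right staircase landing on the top row of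
`H` at `h₀ = (MT, pstar)`. For the compact `Kfam = [-3/5,-1/4] × [-3/20,3/20]` the side mid-edge
`e⋆` of the corridor at height `≈ 0` lies in `Kfam` and carries exactly ONE walk, so
`|F_σ(e⋆)| = x_c^{2 iK2 + 1}` for every spin `σ` (`norm_obs_estar`), while every walk to `b_δ`
first traverses the whole corridor: `|F_σ(b_δ)| ≤ Z(b_δ) ≤ x_c^{J+1} · Σ_{γ ⊂ H : exit → b_δ} x_c^ℓ
≤ x_c^{J+1} · B_{T,L} ≤ x_c^{J+1}` (root-corridor transfer `sum_pow_length_le_corridor`, then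
Duminil-Copin–Smirnov Lemma 2 `DuminilCopinSmirnov2012_lemma2_holds` in a comparison strip rooted
at the corridor's exit dart through the chart `Φfam`, `sum_pow_length_le_stripB`), and
`J + 1 - (2 iK2 + 1) ≥ 4 ⌊iK/2⌋`, `⌊iK/2⌋ ≥ 1/(6δ)`: the eventual inequality
`δ² x^{2iK2+1} ≤ C δ^{-3/4} x^{J+1}` is absurd (`endgame`).

Reusable pieces: §N1 `corridor_prefix` / `corridorSuffix` / `sum_pow_length_le_corridor` (a walk
from a root corridor with an exit to a far target traverses the corridor first; exact length
bookkeeping; `Z_Λ(a → z) ≤ x^{L+1} Z_{Λ∖Γ}(exit → z)`), `norm_obs_corridor_exit_side` (the walk to a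
side mid-edge of a root corridor is unique: `|F_σ| = x^{L+2}`); §N2 `sum_pow_length_le_stripB`,
`sum_pow_length_le_one` (comparison of a sub-domain of a DCS trapezoid with `B_{T,L} ≤ 1` via the
coding of `HexParafermionProofs`); `nonempty_saw_of_linked` (the `Nonempty` clause from
connectedness). Toolkit §A–§F (brick coordinates, `Linked`, `mkSAW`, `verts_eq_corridor`, the
marked rectangle `D₀`, mesh parameters, `endgame`, `aE`/`bE` and their limits) is copied verbatim
from the cdisprove work file `Cruxes/MassRatio/Disproof.lean` (Part II,
refuter-cdisprove-stmt-CriticalPhenomena-8550-g2-0), which is not a build target and cannot be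
imported. This closes the row "exhaustion of compacts: LOAD-BEARING (informal), not formalised" of
that file's hypothesis-mutation table, with a one-corridor witness.
-/

namespace Summit.CriticalPhenomena.SAWScalingLimit.Theorems.MassRatio.Negative.NoExhaustion

open Literature.Probability.LatticeModels Literature.Probability.RandomPlanarGeometry.SAW
open Literature.Probability.RandomPlanarGeometry

/-! ## §A. Brick coordinates on the honeycomb lattice -/


def row (v : HexVertex) : ℤ := v.1 1
def pos (v : HexVertex) : ℤ := 2 * v.1 0 + v.1 1 + ((v.2 : ℕ) : ℤ)
def bv (r p : ℤ) : HexVertex :=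
  (![(p - r - (p - r) % 2) / 2, r], if (p - r) % 2 = 0 then 0 else 1)
@[simp] theorem row_bv (r p : ℤ) : row (bv r p) = r := by simp [row, bv]
theorem pos_bv (r p : ℤ) : pos (bv r p) = p := by
  unfold pos bv
  have h2 : (p - r) % 2 = 0 ∨ (p - r) % 2 = 1 := by omega
  rcases h2 with h | h
  · simp [h]; omega
  · simp [h]; omega
theorem bv_row_pos (v : HexVertex) : bv (row v) (pos v) = v := by
  obtain ⟨x, k⟩ := v
  have hk : k = 0 ∨ k = 1 := by
    rcases k with ⟨k, hk⟩
    have : k = 0 ∨ k = 1 := by omega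
    rcases this with rfl | rfl
    · exact Or.inl rfl
    · exact Or.inr rfl
  refine Prod.ext ?_ ?_
  · funext j
    fin_cases j
    · rcases hk with rfl | rfl
      · simp [bv, row, pos]
      · simp [bv, row, pos]
        omega
    · rcases hk with rfl | rfl <;> simp [bv, row, pos]
  · rcases hk with rfl | rfl
    · simp [bv, row, pos]
    · simp [bv, row, pos]
      omega

theorem bv_inj {r p r' p' : ℤ} (h : bv r p = bv r' p') : r = r' ∧ p = p' := by
  have h1 := congrArg row h
  have h2 := congrArg pos h
  simp only [row_bv, pos_bv] at h1 h2
  exact ⟨h1, h2⟩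

theorem adj_iff (u v : HexVertex) :
    hexGraph.Adj u v ↔
      (row u = row v ∧ (pos v = pos u + 1 ∨ pos v = pos u - 1)) ∨
      (pos u = pos v ∧ row v = row u - 1 ∧ (pos u - row u) % 2 = 0) ∨
      (pos u = pos v ∧ row v = row u + 1 ∧ (pos u - row u) % 2 = 1) := by
  obtain ⟨x, i⟩ := u
  obtain ⟨y, j⟩ := v
  rw [hexGraph_adj_iff_coord]
  unfold row pos
  fin_cases i <;> fin_cases j <;> simp <;> omega
theorem adj_bv_iff (r p r' p' : ℤ) :
    hexGraph.Adj (bv r p) (bv r' p') ↔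
      (r = r' ∧ (p' = p + 1 ∨ p' = p - 1)) ∨
      (p = p' ∧ r' = r - 1 ∧ (p - r) % 2 = 0) ∨
      (p = p' ∧ r' = r + 1 ∧ (p - r) % 2 = 1) := by
  rw [adj_iff]; simp only [row_bv, pos_bv]

/-! ### Geometry of the embedding in brick coordinates -/

theorem triZeta_re : triZeta.re = 1 / 2 := by
  rw [triZeta, show (Real.pi : ℂ) * Complex.I / 3 = ((Real.pi / 3 : ℝ) : ℂ) * Complex.I by push_cast; ring,
    Complex.exp_ofReal_mul_I_re, Real.cos_pi_div_three]

theorem triZeta_im : triZeta.im = Real.sqrt 3 / 2 := by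
  rw [triZeta, show (Real.pi : ℂ) * Complex.I / 3 = ((Real.pi / 3 : ℝ) : ℂ) * Complex.I by push_cast; ring,
    Complex.exp_ofReal_mul_I_im, Real.sin_pi_div_three]

theorem hexCenter_re (v : HexVertex) : (hexCenter v).re = ((pos v : ℝ) + 1) / 2 := by
  obtain ⟨x, k⟩ := v
  simp only [hexCenter, triEmbed, pos, Complex.add_re, Complex.mul_re, Complex.intCast_re,
    Complex.intCast_im, triZeta_re, triZeta_im, Complex.div_re, Complex.one_re,
    Complex.one_im, Complex.add_im]
  fin_cases k <;> simp <;> ring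

theorem hexCenter_im (v : HexVertex) :
    (hexCenter v).im = Real.sqrt 3 / 2 * ((row v : ℝ) + (((v.2 : ℕ) : ℝ) + 1) / 3) := by
  obtain ⟨x, k⟩ := v
  simp only [hexCenter, triEmbed, row, Complex.add_im, Complex.mul_im, Complex.intCast_re,
    Complex.intCast_im, triZeta_re, triZeta_im, Complex.div_im, Complex.one_re,
    Complex.one_im, Complex.add_re]
  fin_cases k <;> simp <;> ring

theorem hexCenter_im_ge (v : HexVertex) :
    Real.sqrt 3 / 2 * ((row v : ℝ) + 1 / 3) ≤ (hexCenter v).im := by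
  rw [hexCenter_im]
  have h3 : (0:ℝ) ≤ Real.sqrt 3 / 2 := by positivity
  have hk : (0:ℝ) ≤ ((v.2 : ℕ) : ℝ) := by positivity
  apply mul_le_mul_of_nonneg_left _ h3
  linarith

theorem hexCenter_im_le (v : HexVertex) :
    (hexCenter v).im ≤ Real.sqrt 3 / 2 * ((row v : ℝ) + 2 / 3) := by
  rw [hexCenter_im]
  have h3 : (0:ℝ) ≤ Real.sqrt 3 / 2 := by positivity
  have hk : ((v.2 : ℕ) : ℝ) ≤ 1 := by
    have : (v.2 : ℕ) ≤ 1 := by have := v.2.isLt; omega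
    exact_mod_cast this
  apply mul_le_mul_of_nonneg_left _ h3
  linarith

/-- midpoint of a horizontal edge (same row `r`, positions `p`, `p+1`). -/
theorem hexMidpoint_bv_horiz_re (r p : ℤ) :
    (hexMidpoint s(bv r p, bv r (p + 1))).re = ((p : ℝ) + 3 / 2) / 2 := by
  rw [hexMidpoint_mk, Complex.div_re, Complex.add_re, hexCenter_re, hexCenter_re, pos_bv, pos_bv]
  simp; ring

/-! ### Linkage inside an induced subgraph -/

/-- `u` and `v` lie in `S` and are joined by a path of the honeycomb lattice inside `S`. -/
def Linked (S : Set HexVertex) (u v : HexVertex) : Prop :=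
  ∃ (hu : u ∈ S) (hv : v ∈ S), (hexGraph.induce S).Reachable ⟨u, hu⟩ ⟨v, hv⟩

theorem Linked.refl {S : Set HexVertex} {u : HexVertex} (hu : u ∈ S) : Linked S u u :=
  ⟨hu, hu, SimpleGraph.Reachable.refl _⟩

theorem Linked.symm {S : Set HexVertex} {u v : HexVertex} (h : Linked S u v) : Linked S v u := by
  obtain ⟨hu, hv, h⟩ := h
  exact ⟨hv, hu, h.symm⟩

theorem Linked.trans {S : Set HexVertex} {u v w : HexVertex} (h₁ : Linked S u v)
    (h₂ : Linked S v w) : Linked S u w := by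
  obtain ⟨hu, hv, h₁⟩ := h₁
  obtain ⟨hv', hw, h₂⟩ := h₂
  exact ⟨hu, hw, h₁.trans h₂⟩

theorem linked_of_adj {S : Set HexVertex} {u v : HexVertex} (hu : u ∈ S) (hv : v ∈ S)
    (h : hexGraph.Adj u v) : Linked S u v :=
  ⟨hu, hv, SimpleGraph.Adj.reachable (by simpa [SimpleGraph.comap_adj] using h)⟩

theorem Linked.mono {S T : Set HexVertex} {u v : HexVertex} (hST : S ⊆ T) (h : Linked S u v) :
    Linked T u v := by
  obtain ⟨hu, hv, h⟩ := h
  exact ⟨hST hu, hST hv, h.map (SimpleGraph.induceHomOfLE hexGraph hST).toHom⟩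

theorem Linked.mem_left {S : Set HexVertex} {u v : HexVertex} (h : Linked S u v) : u ∈ S := h.1
theorem Linked.mem_right {S : Set HexVertex} {u v : HexVertex} (h : Linked S u v) : v ∈ S := h.2.1

theorem preconnected_of_linked {S : Set HexVertex}
    (h : ∀ u ∈ S, ∀ v ∈ S, Linked S u v) : (hexGraph.induce S).Preconnected := by
  rintro ⟨u, hu⟩ ⟨v, hv⟩
  obtain ⟨_, _, h⟩ := h u hu v hv
  exact h

/-- A horizontal run inside `S`. -/
theorem linked_run {S : Set HexVertex} (r p : ℤ) (n : ℕ)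
    (h : ∀ i : ℕ, i ≤ n → bv r (p + i) ∈ S) : Linked S (bv r p) (bv r (p + n)) := by
  induction n with
  | zero => simpa using Linked.refl (h 0 le_rfl)
  | succ n ih =>
    have h1 : Linked S (bv r p) (bv r (p + n)) := ih fun i hi => h i (by omega)
    refine h1.trans (linked_of_adj (h n (by omega)) ?_ ?_)
    · have := h (n + 1) le_rfl
      simpa [Nat.cast_succ, add_assoc] using this
    · rw [adj_bv_iff]; left; exact ⟨rfl, Or.inl (by push_cast; ring)⟩

/-- A horizontal run inside `S`, integer form: from position `p` to position `q ≥ p`. -/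
theorem linked_run' {S : Set HexVertex} (r p q : ℤ) (hpq : p ≤ q)
    (h : ∀ t : ℤ, p ≤ t → t ≤ q → bv r t ∈ S) : Linked S (bv r p) (bv r q) := by
  obtain ⟨n, rfl⟩ : ∃ n : ℕ, q = p + n := ⟨(q - p).toNat, by omega⟩
  exact linked_run r p n fun i hi => h _ (by omega) (by omega)

/-- One step down inside the band `{q, q+1}`: rows `r` and `r-1` of the band in `S`. -/
theorem linked_band_down {S : Set HexVertex} (r q : ℤ)
    (h0 : bv r q ∈ S) (h1 : bv r (q + 1) ∈ S) (h2 : bv (r - 1) q ∈ S) (h3 : bv (r - 1) (q + 1) ∈ S) :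
    Linked S (bv r q) (bv (r - 1) q) := by
  have hq : (q - r) % 2 = 0 ∨ (q + 1 - r) % 2 = 0 := by omega
  rcases hq with hq | hq
  · exact linked_of_adj h0 h2 (by rw [adj_bv_iff]; right; left; exact ⟨rfl, rfl, hq⟩)
  · have a1 : Linked S (bv r q) (bv r (q + 1)) :=
      linked_of_adj h0 h1 (by rw [adj_bv_iff]; left; exact ⟨rfl, Or.inl rfl⟩)
    have a2 : Linked S (bv r (q + 1)) (bv (r - 1) (q + 1)) :=
      linked_of_adj h1 h3 (by rw [adj_bv_iff]; right; left; exact ⟨rfl, rfl, hq⟩)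
    have a3 : Linked S (bv (r - 1) (q + 1)) (bv (r - 1) q) :=
      linked_of_adj h3 h2 (by rw [adj_bv_iff]; left; exact ⟨rfl, Or.inr (by ring)⟩)
    exact (a1.trans a2).trans a3

/-- Descending `n` rows inside the band `{q, q+1}`. -/
theorem linked_band_descend {S : Set HexVertex} (r q : ℤ) (n : ℕ)
    (h : ∀ i : ℕ, i ≤ n → bv (r - i) q ∈ S ∧ bv (r - i) (q + 1) ∈ S) :
    Linked S (bv r q) (bv (r - n) q) := by
  induction n with
  | zero => simpa using Linked.refl (h 0 le_rfl).1
  | succ n ih =>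
    have h1 : Linked S (bv r q) (bv (r - n) q) := ih fun i hi => h i (by omega)
    have step := linked_band_down (S := S) (r - n) q (h n (by omega)).1 (h n (by omega)).2
      (by have := (h (n+1) le_rfl).1; convert this using 2; push_cast; ring)
      (by have := (h (n+1) le_rfl).2; convert this using 2; push_cast; ring)
    refine h1.trans ?_
    convert step using 2; push_cast; ring

/-- Vertical linkage inside a band `{q, q+1} × [r₁, r₂] ⊆ S`: from row `r₂` down to row `r₁`. -/
theorem linked_band {S : Set HexVertex} (q r₁ r₂ : ℤ) (h12 : r₁ ≤ r₂)
    (h : ∀ r : ℤ, r₁ ≤ r → r ≤ r₂ → bv r q ∈ S ∧ bv r (q + 1) ∈ S) :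
    Linked S (bv r₂ q) (bv r₁ q) := by
  obtain ⟨n, rfl⟩ : ∃ n : ℕ, r₁ = r₂ - n := ⟨(r₂ - r₁).toNat, by omega⟩
  exact linked_band_descend r₂ q n fun i hi => h _ (by omega) (by
    have : (0:ℤ) ≤ i := by positivity
    linarith)



/-! ### Self-avoiding walks from vertex lists -/

/-- A self-avoiding walk of the domain `Λ` from the mid-edge `s(u, w)` (entered at `w`) to the
mid-edge `z`, built from its nonempty duplicate-free chain of vertices `l` (`u ∉ l`, some endpoint
of `z` off `l`). -/
def mkSAW (Λ : Finset HexVertex) (u w : HexVertex) (z : Sym2 HexVertex) (l : List HexVertex)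
    (hl : l ≠ []) (hsub : ∀ v ∈ l, v ∈ Λ) (hnd : l.Nodup) (hch : l.IsChain hexGraph.Adj)
    (hhead : l.head hl = w) (hlast : l.getLast hl ∈ z) (huw : hexGraph.Adj u w) (hw : w ∈ Λ)
    (hu : u ∉ l) (hz : ∃ t ∈ z, t ∉ l) (haz : s(u, w) ≠ z) : HexMidEdgeSAW Λ s(u, w) z where
  verts := l
  subset := hsub
  nodup := hnd
  isChain := hch
  head_mem := by
    intro v hv
    rw [List.head?_eq_some_head hl, Option.some_inj] at hv
    rw [← hv, hhead]; exact Sym2.mem_mk_right _ _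
  getLast_mem := by
    intro v hv
    rw [List.getLast?_eq_some_getLast hl, Option.some_inj] at hv
    rw [← hv]; exact hlast
  eq_of_nil := fun h => (hl h).elim
  edges_nodup := fun _ => by
    have hE := edges_nodup hnd
    have haE : s(u, w) ∉ List.zipWith (fun u w => s(u, w)) l l.tail := fun h =>
      hu (forall_mem_of_mem_edges l _ h u (Sym2.mem_mk_left _ _))
    have hzE : z ∉ List.zipWith (fun u w => s(u, w)) l l.tail := fun h => by
      obtain ⟨t, ht, htl⟩ := hz
      exact htl (forall_mem_of_mem_edges l _ h t ht)
    have hdis : ∀ e ∈ s(u, w) :: List.zipWith (fun u w => s(u, w)) l l.tail, ∀ e' ∈ [z],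
        e ≠ e' := by
      intro e he e' he' hee
      rw [List.mem_singleton] at he'
      rw [he'] at hee
      rw [hee] at he
      rcases List.mem_cons.1 he with h | h
      · exact haz h.symm
      · exact hzE h
    exact List.nodup_append.2 ⟨List.nodup_cons.2 ⟨haE, hE⟩, List.nodup_singleton _, hdis⟩
  fst_mem := ⟨(SimpleGraph.mem_edgeSet _).2 huw, w, Sym2.mem_mk_right _ _, hw⟩

@[simp] theorem mkSAW_length (Λ : Finset HexVertex) (u w : HexVertex) (z : Sym2 HexVertex)
    (l : List HexVertex) (hl hsub hnd hch hhead hlast huw hw hu hz haz) :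
    (mkSAW Λ u w z l hl hsub hnd hch hhead hlast huw hw hu hz haz).length = l.length := rfl

/-! ### Values of `Z = F_{x,0}` -/

/-- Every exhibited walk gives the lower bound `x^{ℓ(γ)} ≤ |Z(z)|`. -/
theorem pow_length_le_norm_Z (Λ : Finset HexVertex) (a z : Sym2 HexVertex)
    (γ : HexMidEdgeSAW Λ a z) {x : ℝ} (hx : 0 ≤ x) :
    x ^ γ.length ≤ ‖hexParafermionicObservable Λ a x 0 z‖ := by
  rw [hexParafermionicObservable_zero_spin, Complex.norm_real,
    Real.norm_of_nonneg (Finset.sum_nonneg fun γ _ => pow_nonneg hx _)]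
  exact Finset.single_le_sum (fun γ _ => pow_nonneg hx _) (Finset.mem_univ γ)

/-- `|Z(z)| ≥ 0` is a sum of nonnegative reals. -/
theorem norm_Z_eq_sum (Λ : Finset HexVertex) (a z : Sym2 HexVertex) {x : ℝ} (hx : 0 ≤ x) :
    ‖hexParafermionicObservable Λ a x 0 z‖ = ∑ γ : HexMidEdgeSAW Λ a z, x ^ γ.length := by
  rw [hexParafermionicObservable_zero_spin, Complex.norm_real,
    Real.norm_of_nonneg (Finset.sum_nonneg fun γ _ => pow_nonneg hx _)]

/-- If all walks `a → z` coincide with `γ₀`, then `|Z(z)| = x^{ℓ(γ₀)}`. -/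
theorem norm_Z_eq_of_unique {Λ : Finset HexVertex} {a z : Sym2 HexVertex}
    (γ₀ : HexMidEdgeSAW Λ a z) (h : ∀ γ : HexMidEdgeSAW Λ a z, γ = γ₀) {x : ℝ} (hx : 0 ≤ x) :
    ‖hexParafermionicObservable Λ a x 0 z‖ = x ^ γ₀.length := by
  letI : Unique (HexMidEdgeSAW Λ a z) := ⟨⟨γ₀⟩, h⟩
  rw [hexParafermionicObservable, Fintype.sum_unique, HexMidEdgeSAW.norm_weight _ hx]
  rfl

/-! ### Bare corridors hanging off the root vertex: the walk to the tip is unique -/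

section Corridor

variable {Λ : Finset HexVertex} {u y : HexVertex} {c : ℕ → HexVertex} {L : ℕ}

/-- **Uniqueness of the walk down a bare root-attached corridor.** `c 0` is the root vertex (the
endpoint in `Λ` of the root mid-edge `s(u, c 0)`, `u ∉ Λ`), `c 1, …, c L` a corridor whose only
`Λ`-neighbours are its corridor neighbours (and `c 0` for `c 1`), tip mid-edge `s(c L, y)`,
`y ∉ Λ`. Then every self-avoiding walk from the root to the tip IS the corridor. -/
theorem verts_eq_corridor (hu : u ∉ Λ) (hy : y ∉ Λ)
    (hinj : ∀ i j, i ≤ L → j ≤ L → c i = c j → i = j)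
    (hbare : ∀ i, 1 ≤ i → i ≤ L → ∀ v ∈ Λ, hexGraph.Adj (c i) v →
      v = c (i - 1) ∨ (i < L ∧ v = c (i + 1)))
    (haz : s(u, c 0) ≠ s(c L, y))
    (γ : HexMidEdgeSAW Λ s(u, c 0) s(c L, y)) :
    γ.verts = (List.range (L + 1)).map c := by
  set l := γ.verts with hl
  have hne : l ≠ [] := fun h => haz (γ.eq_of_nil h)
  have hn : 0 < l.length := List.length_pos_iff.2 hne
  -- endpoints
  have hmemΛ : ∀ (i : ℕ) (hi : i < l.length), l[i] ∈ Λ := fun i hi => γ.subset _ (List.getElem_mem _)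
  have h0 : l[0] = c 0 := by
    have hmem := γ.head_mem (l.head hne) (List.head?_eq_some_head hne)
    rw [List.head_eq_getElem] at hmem
    rcases Sym2.mem_iff.1 hmem with h | h
    · have hΛ := hmemΛ 0 hn
      rw [h] at hΛ
      exact absurd hΛ hu
    · exact h
  have hlast : l[l.length - 1] = c L := by
    have hmem := γ.getLast_mem (l.getLast hne) (List.getLast?_eq_some_getLast hne)
    rw [List.getLast_eq_getElem] at hmem
    rcases Sym2.mem_iff.1 hmem with h | h
    · exact h
    · have hΛ := hmemΛ (l.length - 1) (by omega)
      rw [h] at hΛ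
      exact absurd hΛ hy
  have hchain : ∀ (i : ℕ) (hi : i + 1 < l.length), hexGraph.Adj l[i] l[i + 1] :=
    fun i hi => List.isChain_iff_getElem.1 γ.isChain i hi
  have hnod : ∀ (i j : ℕ) (hi : i < l.length) (hj : j < l.length), l[i] = l[j] → i = j :=
    fun i j hi hj h => (γ.nodup.getElem_inj_iff).1 h
  -- the case of a one-vertex walk
  by_cases hn1 : l.length = 1
  · have hL : L = 0 := by
      have : c 0 = c L := by rw [← h0, ← hlast]; congr 1; omega
      exact (hinj 0 L (Nat.zero_le _) le_rfl this).symm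
    subst hL
    apply List.ext_getElem (by simp [hn1])
    intro i hi hi'
    have : i = 0 := by omega
    subst this
    simpa using h0
  have hn2 : 2 ≤ l.length := by omega
  -- `L ≥ 1`
  have hL1 : 1 ≤ L := by
    by_contra hL
    have hL0 : L = 0 := by omega
    have : l[l.length - 1] = l[0] := by rw [hlast, h0, hL0]
    have := hnod _ _ (by omega) hn this
    omega
  by_cases h1 : l[1] = c 1
  · -- the walk goes down the corridor
    have claimA : ∀ j (hj : j < l.length), j ≤ L ∧ l[j] = c j := by
      intro j
      induction j using Nat.strong_induction_on with
      | _ j ih =>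
        intro hj
        match j with
        | 0 => exact ⟨Nat.zero_le _, h0⟩
        | 1 => exact ⟨hL1, h1⟩
        | j + 2 =>
          obtain ⟨hjL, hj1⟩ := ih (j + 1) (by omega) (by omega)
          obtain ⟨-, hj0⟩ := ih j (by omega) (by omega)
          have hadj : hexGraph.Adj (c (j + 1)) l[j + 2] := by
            have := hchain (j + 1) (by omega)
            rwa [hj1] at this
          rcases hbare (j + 1) (by omega) hjL _ (hmemΛ _ hj) hadj with h | ⟨hlt, h⟩
          · exfalso
            have : l[j + 2] = l[j] := by rw [h, hj0]; rfl
            have := hnod _ _ hj (by omega) this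
            omega
          · exact ⟨by omega, h⟩
    have hlen : l.length = L + 1 := by
      obtain ⟨hle, heq⟩ := claimA (l.length - 1) (by omega)
      have : c (l.length - 1) = c L := by rw [← heq, hlast]
      have := hinj _ _ hle le_rfl this
      omega
    apply List.ext_getElem (by simp [hlen])
    intro i hi hi'
    simp only [List.getElem_map, List.getElem_range]
    exact (claimA i hi).2
  · -- the walk leaves the corridor at the root: it can never come back
    exfalso
    have claimB : ∀ j, 1 ≤ j → ∀ (hj : j < l.length), ∀ i, 1 ≤ i → i ≤ L → l[j] ≠ c i := by
      intro j hj1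
      induction j with
      | zero => omega
      | succ j ih =>
        intro hj i hi1 hiL heq
        rcases Nat.eq_zero_or_pos j with rfl | hjpos
        · -- `j + 1 = 1`
          have hadj : hexGraph.Adj (c i) (c 0) := by
            have := hchain 0 (by omega)
            rw [h0] at this
            simp only [zero_add] at heq
            rw [heq] at this
            exact this.symm
          have hc0 : c 0 ∈ Λ := by have := hmemΛ 0 hn; rwa [h0] at this
          rcases hbare i hi1 hiL _ hc0 hadj with h | ⟨hlt, h⟩
          · have := hinj 0 (i - 1) (Nat.zero_le _) (by omega) h
            have hi : i = 1 := by omega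
            subst hi
            exact h1 heq
          · have := hinj 0 (i + 1) (Nat.zero_le _) (by omega) h
            omega
        · have hadj : hexGraph.Adj (c i) l[j] := by
            have := hchain j (by omega)
            rw [heq] at this
            exact this.symm
          rcases hbare i hi1 hiL _ (hmemΛ j (by omega)) hadj with h | ⟨hlt, h⟩
          · rcases Nat.eq_zero_or_pos (i - 1) with hi0 | hipos
            · have hi : i = 1 := by omega
              subst hi
              have : l[j] = l[0] := by rw [h, h0]
              have := hnod _ _ (by omega) hn this
              omega
            · exact ih (by omega) (by omega) (i - 1) hipos (by omega) h
          · exact ih (by omega) (by omega) (i + 1) (by omega) (by omega) h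
    exact claimB (l.length - 1) (by omega) (by omega) L hL1 le_rfl hlast

/-- The corridor walk itself. -/
def corridorWalk (hcΛ : ∀ i, i ≤ L → c i ∈ Λ)
    (hinj : ∀ i j, i ≤ L → j ≤ L → c i = c j → i = j)
    (hadj : ∀ i, i < L → hexGraph.Adj (c i) (c (i + 1)))
    (huc : hexGraph.Adj u (c 0)) (hu : u ∉ Λ) (hy : y ∉ Λ)
    (haz : s(u, c 0) ≠ s(c L, y)) : HexMidEdgeSAW Λ s(u, c 0) s(c L, y) :=
  mkSAW Λ u (c 0) s(c L, y) ((List.range (L + 1)).map c) (by simp)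
    (by
      intro v hv
      simp only [List.mem_map, List.mem_range] at hv
      obtain ⟨i, hi, rfl⟩ := hv
      exact hcΛ i (by omega))
    (by
      refine List.Nodup.map_on ?_ List.nodup_range
      intro i hi j hj h
      simp only [List.mem_range] at hi hj
      exact hinj i j (by omega) (by omega) h)
    (by
      refine List.isChain_iff_getElem.2 ?_
      intro i hi
      simp only [List.length_map, List.length_range] at hi
      simp only [List.getElem_map, List.getElem_range]
      exact hadj i (by omega))
    (by simp [List.range_succ_eq_map])
    (by
      rw [List.getLast_eq_getElem]
      simp [List.getElem_map, List.getElem_range])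
    huc (hcΛ 0 (Nat.zero_le _))
    (by
      simp only [List.mem_map, List.mem_range, not_exists, not_and]
      intro i hi h
      exact hu (h ▸ hcΛ i (by omega)))
    ⟨y, Sym2.mem_mk_right _ _, by
      simp only [List.mem_map, List.mem_range, not_exists, not_and]
      intro i hi h
      exact hy (h ▸ hcΛ i (by omega))⟩
    haz

/-- **The mass at the tip of a bare root-attached corridor of `L` vertices is exactly `x^{L+1}`.** -/
theorem norm_Z_corridor_tip (hcΛ : ∀ i, i ≤ L → c i ∈ Λ)
    (hinj : ∀ i j, i ≤ L → j ≤ L → c i = c j → i = j)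
    (hadj : ∀ i, i < L → hexGraph.Adj (c i) (c (i + 1)))
    (huc : hexGraph.Adj u (c 0)) (hu : u ∉ Λ) (hy : y ∉ Λ)
    (hbare : ∀ i, 1 ≤ i → i ≤ L → ∀ v ∈ Λ, hexGraph.Adj (c i) v →
      v = c (i - 1) ∨ (i < L ∧ v = c (i + 1)))
    (haz : s(u, c 0) ≠ s(c L, y)) {x : ℝ} (hx : 0 ≤ x) :
    ‖hexParafermionicObservable Λ s(u, c 0) x 0 s(c L, y)‖ = x ^ (L + 1) := by
  have h := norm_Z_eq_of_unique (corridorWalk hcΛ hinj hadj huc hu hy haz) (fun γ =>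
    HexMidEdgeSAW.ext (by
      rw [verts_eq_corridor hu hy hinj hbare haz γ]
      rfl)) hx
  rw [h]
  simp [corridorWalk]

end Corridor



/-! ### The Dobrushin domain: the rectangle `(-2,2)×(-1,1)` marked at `-1 - i` and `1 - i` -/

/-- The rectangle `(-2, 2) × (-1, 1)` with marked points `a = -1 - i` (mark `1/16`) and
`b = 1 - i` (mark `3/16`), both on the bottom side; the boundary is flat (horizontal, domain above)
in the ball of radius `1` about `b`. -/

noncomputable def D₀ : DobrushinDomain where
  toJordanDomain := rectDomain 2 1 two_pos one_pos
  mark := ![1 / 16, 3 / 16]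
  strictMono_mark := by
    refine Fin.strictMono_iff_lt_succ.2 fun k => ?_
    fin_cases k
    simp
    norm_num
  mark_mem k := by fin_cases k <;> simp <;> norm_num

theorem D₀_carrier : D₀.carrier = symRect 2 1 := rfl

theorem mem_D₀_carrier {z : ℂ} : z ∈ D₀.carrier ↔ (-2 < z.re ∧ z.re < 2) ∧ (-1 < z.im ∧ z.im < 1) :=
  mem_symRect

theorem D₀_pt0 : D₀.pt 0 = ⟨-1, -1⟩ := by
  show polygonLoop (rectVerts 2 1) (1 / 16) = _
  have h := polygonLoop_apply_div (l := rectVerts 2 1) (k := 0) (by simp) (θ := 1 / 4)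
    ⟨by norm_num, by norm_num⟩
  rw [show ((0 : ℕ) + 1 / 4 : ℝ) / (rectVerts 2 1).length = 1 / 16 by simp; norm_num] at h
  rw [h]
  apply Complex.ext <;> simp [rectVerts, AffineMap.lineMap_apply_module']
  norm_num

theorem D₀_pt1 : D₀.pt 1 = ⟨1, -1⟩ := by
  show polygonLoop (rectVerts 2 1) (3 / 16) = _
  have h := polygonLoop_apply_div (l := rectVerts 2 1) (k := 0) (by simp) (θ := 3 / 4)
    ⟨by norm_num, by norm_num⟩
  rw [show ((0 : ℕ) + 3 / 4 : ℝ) / (rectVerts 2 1).length = 3 / 16 by simp; norm_num] at h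
  rw [h]
  apply Complex.ext <;> simp [rectVerts, AffineMap.lineMap_apply_module']
  norm_num

/-- The boundary of `D₀` is flat near `b = 1 - i`: within the unit ball about `b` the domain is
the upper half-plane `Im z > -1`. -/
theorem D₀_flat : D₀.carrier ∩ Metric.ball (D₀.pt 1) 1 =
    {z : ℂ | (D₀.pt 1).im < z.im} ∩ Metric.ball (D₀.pt 1) 1 := by
  ext z
  simp only [Set.mem_inter_iff, mem_D₀_carrier, Set.mem_setOf_eq, D₀_pt1, Metric.mem_ball]
  constructor
  · rintro ⟨⟨-, h3, -⟩, hz⟩; exact ⟨h3, hz⟩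
  · rintro ⟨h3, hz⟩
    have hre : |z.re - 1| < 1 := by
      have := Complex.abs_re_le_norm (z - ⟨1, -1⟩)
      rw [Complex.dist_eq] at hz
      simp at this; linarith
    have him : |z.im + 1| < 1 := by
      have := Complex.abs_im_le_norm (z - ⟨1, -1⟩)
      rw [Complex.dist_eq] at hz
      simp at this; linarith
    rw [abs_lt] at hre him
    exact ⟨⟨⟨by linarith, by linarith⟩, h3, by linarith⟩, hz⟩

/-! ### Mesh parameters -/

/-- The row height unit `√3/2` of the honeycomb lattice. -/
noncomputable def hgt : ℝ := Real.sqrt 3 / 2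

theorem hgt_pos : 0 < hgt := by unfold hgt; positivity

theorem sqrt3_gt : (17 : ℝ) / 10 < Real.sqrt 3 := by
  rw [show (17:ℝ)/10 = Real.sqrt ((17/10)^2) by rw [Real.sqrt_sq]; norm_num]
  exact Real.sqrt_lt_sqrt (by norm_num) (by norm_num)

theorem sqrt3_lt : Real.sqrt 3 < (7 : ℝ) / 4 := by
  rw [show (7:ℝ)/4 = Real.sqrt ((7/4)^2) by rw [Real.sqrt_sq]; norm_num]
  exact Real.sqrt_lt_sqrt (by norm_num) (by norm_num)

theorem hgt_gt : (17 : ℝ) / 20 < hgt := by unfold hgt; linarith [sqrt3_gt]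
theorem hgt_lt : hgt < 7 / 8 := by unfold hgt; linarith [sqrt3_lt]

/-- bottom row of the discretisation: least `r` with `δ·hgt·(r + 1/3) > -1` -/
noncomputable def mRow (δ : ℝ) : ℤ := ⌊-(1 / (δ * hgt)) - 1 / 3⌋ + 1
/-- top row: largest `r` with `δ·hgt·(r + 2/3) < 1` -/
noncomputable def MRow (δ : ℝ) : ℤ := ⌈1 / (δ * hgt) - 2 / 3⌉ - 1
/-- largest position with `δ (p+1)/2 < 2` -/
noncomputable def PPos (δ : ℝ) : ℤ := ⌈4 * (1 / δ) - 1⌉ - 1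
/-- position of the root mid-edge `a_δ` (near `Re = -1`), of the parity of the bottom row -/
noncomputable def pA (δ : ℝ) : ℤ := 2 * ⌊(-(2 * (1 / δ)) - 1 - mRow δ) / 2⌋ + mRow δ
/-- position of the far mid-edge `b_δ` (near `Re = 1`), of the parity of the bottom row -/
noncomputable def pB (δ : ℝ) : ℤ := 2 * ⌊(2 * (1 / δ) - 1 - mRow δ) / 2⌋ + mRow δ
/-- number of rows climbed by the comparison walk into `K` (height `2/5` above the bottom) -/
noncomputable def iK (δ : ℝ) : ℕ := ⌊2 * (1 / (δ * hgt)) / 5⌋₊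

section Params

variable {δ : ℝ}

theorem t_mul (hδ : 0 < δ) : δ * hgt * (1 / (δ * hgt)) = 1 := by
  have := hgt_pos.ne'; field_simp

theorem s_mul (hδ : 0 < δ) : δ * (1 / δ) = 1 := by field_simp

theorem s_eq (hδ : 0 < δ) : 1 / δ = hgt * (1 / (δ * hgt)) := by
  have := hgt_pos.ne'; field_simp

theorem t_ge (hδ : 0 < δ) (hδ1 : δ ≤ 1 / 100) : 100 ≤ 1 / (δ * hgt) := by
  have h1 := hgt_pos
  have h2 := hgt_lt
  rw [le_div_iff₀ (by positivity)]
  nlinarith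

theorem mRow_le (δ : ℝ) : (mRow δ : ℝ) ≤ -(1 / (δ * hgt)) + 2 / 3 := by
  have := Int.floor_le (-(1 / (δ * hgt)) - 1 / 3)
  unfold mRow; push_cast; linarith

theorem lt_mRow (δ : ℝ) : -(1 / (δ * hgt)) - 1 / 3 < mRow δ := by
  have := Int.lt_floor_add_one (-(1 / (δ * hgt)) - 1 / 3)
  unfold mRow; push_cast; linarith

theorem le_MRow (δ : ℝ) : 1 / (δ * hgt) - 5 / 3 ≤ MRow δ := by
  have := Int.le_ceil (1 / (δ * hgt) - 2 / 3)
  unfold MRow; push_cast; linarith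

theorem MRow_lt (δ : ℝ) : (MRow δ : ℝ) < 1 / (δ * hgt) - 2 / 3 := by
  have := Int.ceil_lt_add_one (1 / (δ * hgt) - 2 / 3)
  unfold MRow; push_cast; linarith

theorem le_PPos (δ : ℝ) : 4 * (1 / δ) - 2 ≤ PPos δ := by
  have := Int.le_ceil (4 * (1 / δ) - 1)
  unfold PPos; push_cast; linarith

theorem PPos_lt (δ : ℝ) : (PPos δ : ℝ) < 4 * (1 / δ) - 1 := by
  have := Int.ceil_lt_add_one (4 * (1 / δ) - 1)
  unfold PPos; push_cast; linarith

theorem pA_le (δ : ℝ) : (pA δ : ℝ) ≤ -(2 * (1 / δ)) - 1 := by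
  have := Int.floor_le ((-(2 * (1 / δ)) - 1 - mRow δ) / 2)
  unfold pA; push_cast; linarith

theorem lt_pA (δ : ℝ) : -(2 * (1 / δ)) - 3 < pA δ := by
  have := Int.lt_floor_add_one ((-(2 * (1 / δ)) - 1 - mRow δ) / 2)
  unfold pA; push_cast; linarith

theorem pA_mod (δ : ℝ) : (pA δ - mRow δ) % 2 = 0 := by
  unfold pA; omega

theorem pB_le (δ : ℝ) : (pB δ : ℝ) ≤ 2 * (1 / δ) - 1 := by
  have := Int.floor_le ((2 * (1 / δ) - 1 - mRow δ) / 2)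
  unfold pB; push_cast; linarith

theorem lt_pB (δ : ℝ) : 2 * (1 / δ) - 3 < pB δ := by
  have := Int.lt_floor_add_one ((2 * (1 / δ) - 1 - mRow δ) / 2)
  unfold pB; push_cast; linarith

theorem pB_mod (δ : ℝ) : (pB δ - mRow δ) % 2 = 0 := by
  unfold pB; omega

theorem iK_le' (hδ : 0 < δ) : (iK δ : ℝ) ≤ 2 * (1 / (δ * hgt)) / 5 := by
  have h := Nat.floor_le (show (0:ℝ) ≤ 2 * (1 / (δ * hgt)) / 5 by have := hgt_pos; positivity)
  unfold iK; exact h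

theorem lt_iK' (δ : ℝ) : 2 * (1 / (δ * hgt)) / 5 - 1 < (iK δ : ℝ) := by
  have h := Nat.lt_floor_add_one (2 * (1 / (δ * hgt)) / 5)
  unfold iK; linarith

theorem iK_le (hδ : 0 < δ) : δ * hgt * (iK δ) ≤ 2 / 5 := by
  have h := iK_le' hδ
  have hp : 0 < δ * hgt := by have := hgt_pos; positivity
  have ht := t_mul hδ
  nlinarith

theorem lt_iK (hδ : 0 < δ) : 2 / 5 - δ * hgt < δ * hgt * (iK δ) := by
  have h := lt_iK' δ
  have hp : 0 < δ * hgt := by have := hgt_pos; positivity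
  have ht := t_mul hδ
  nlinarith

/-- bottom heights: rows `≥ m` lie above `Im = -1` after scaling -/
theorem mRow_height (hδ : 0 < δ) : -1 < δ * hgt * ((mRow δ : ℝ) + 1 / 3) := by
  have h := lt_mRow δ
  have hp : 0 < δ * hgt := by have := hgt_pos; positivity
  have ht := t_mul hδ
  nlinarith

theorem mRow_height' (hδ : 0 < δ) : δ * hgt * ((mRow δ : ℝ) - 2 / 3) ≤ -1 := by
  have h := mRow_le δ
  have hp : 0 < δ * hgt := by have := hgt_pos; positivity
  have ht := t_mul hδ
  nlinarith

theorem MRow_height (hδ : 0 < δ) : δ * hgt * ((MRow δ : ℝ) + 2 / 3) < 1 := by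
  have h := MRow_lt δ
  have hp : 0 < δ * hgt := by have := hgt_pos; positivity
  have ht := t_mul hδ
  nlinarith

theorem PPos_width (hδ : 0 < δ) : δ * ((PPos δ : ℝ) + 1) / 2 < 2 := by
  have h := PPos_lt δ
  have := s_mul hδ
  nlinarith

theorem PPos_width' (hδ : 0 < δ) : -2 < δ * (-(PPos δ : ℝ) + 1) / 2 := by
  have h := PPos_lt δ
  have := s_mul hδ
  nlinarith

theorem pA_re (hδ : 0 < δ) :
    δ * ((pA δ : ℝ) + 1) / 2 ≤ -1 ∧ -1 - δ < δ * ((pA δ : ℝ) + 1) / 2 := by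
  have h1 := pA_le δ
  have h2 := lt_pA δ
  have := s_mul hδ
  constructor <;> nlinarith

theorem pB_re (hδ : 0 < δ) :
    δ * ((pB δ : ℝ) + 1) / 2 ≤ 1 ∧ 1 - δ < δ * ((pB δ : ℝ) + 1) / 2 := by
  have h1 := pB_le δ
  have h2 := lt_pB δ
  have := s_mul hδ
  constructor <;> nlinarith

/-- All the integer inequalities between the parameters used below, for `0 < δ ≤ 1/100`. -/
theorem params (hδ : 0 < δ) (hδ1 : δ ≤ 1 / 100) :
    mRow δ + 3 + (iK δ : ℤ) + 1 ≤ MRow δ ∧ 0 ≤ MRow δ ∧ mRow δ ≤ -10 ∧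
    -PPos δ ≤ pA δ - (iK δ : ℤ) - 4 ∧ pA δ ≤ -10 ∧ 10 ≤ pB δ ∧ pB δ ≤ PPos δ ∧
    (100 : ℤ) ≤ PPos δ ∧ ((4 * (iK δ / 2) + 2 * iK δ : ℕ) : ℤ) ≤ pB δ - pA δ - 1 ∧
    ((4 * (iK δ / 2) + 2 * iK δ : ℕ) : ℤ) ≤ -6 - pA δ ∧ 1 / (6 * δ) ≤ ((iK δ / 2 : ℕ) : ℝ) := by
  have ht := t_ge hδ hδ1
  have hs := s_eq hδ
  set t := 1 / (δ * hgt) with ht_def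
  set s := 1 / δ with hs_def
  have hg1 := hgt_gt
  have hg2 := hgt_lt
  have h1 := mRow_le δ
  have h2 := lt_mRow δ
  have h3 := le_MRow δ
  have h4 := MRow_lt δ
  have h5 := le_PPos δ
  have h6 := PPos_lt δ
  have h7 := pA_le δ
  have h8 := lt_pA δ
  have h9 := pB_le δ
  have h10 := lt_pB δ
  have h11 := iK_le' hδ
  have h12 := lt_iK' δ
  simp only [← ht_def, ← hs_def] at h1 h2 h3 h4 h5 h6 h7 h8 h9 h10 h11 h12
  have hik0 : (0:ℝ) ≤ (iK δ : ℝ) := by positivity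
  have hdiv1 : (iK δ : ℝ) ≤ 2 * ((iK δ / 2 : ℕ) : ℝ) + 1 := by
    have : iK δ ≤ 2 * (iK δ / 2) + 1 := by omega
    exact_mod_cast this
  have hdiv2 : 2 * ((iK δ / 2 : ℕ) : ℝ) ≤ (iK δ : ℝ) := by
    have : 2 * (iK δ / 2) ≤ iK δ := by omega
    exact_mod_cast this
  refine ⟨?_, ?_, ?_, ?_, ?_, ?_, ?_, ?_, ?_, ?_, ?_⟩
  · have : (mRow δ : ℝ) + 3 + (iK δ : ℝ) + 1 ≤ MRow δ := by nlinarith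
    exact_mod_cast this
  · have : (0 : ℝ) ≤ MRow δ := by nlinarith
    exact_mod_cast this
  · have : (mRow δ : ℝ) ≤ -10 := by nlinarith
    exact_mod_cast this
  · have : -(PPos δ : ℝ) ≤ pA δ - (iK δ : ℝ) - 4 := by nlinarith
    exact_mod_cast this
  · have : (pA δ : ℝ) ≤ -10 := by nlinarith
    exact_mod_cast this
  · have : (10 : ℝ) ≤ pB δ := by nlinarith
    exact_mod_cast this
  · have : (pB δ : ℝ) ≤ PPos δ := by nlinarith
    exact_mod_cast this
  · have : (100 : ℝ) ≤ PPos δ := by nlinarith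
    exact_mod_cast this
  · have : ((4 * (iK δ / 2) + 2 * iK δ : ℕ) : ℝ) ≤ ((pB δ - pA δ - 1 : ℤ) : ℝ) := by
      push_cast; nlinarith
    exact (Int.cast_le (R := ℝ)).1 (by rw [Int.cast_natCast]; exact this)
  · have : ((4 * (iK δ / 2) + 2 * iK δ : ℕ) : ℝ) ≤ ((-6 - pA δ : ℤ) : ℝ) := by
      push_cast; nlinarith
    exact (Int.cast_le (R := ℝ)).1 (by rw [Int.cast_natCast]; exact this)
  · have : 1 / (6 * δ) = s / 6 := by rw [hs_def]; ring
    rw [this]; nlinarith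

end Params



/-! ## §E. Common tools: finiteness of mid-edge sets, heights of brick vertices, endgame -/


theorem neighbors_finite (v : HexVertex) : {w | hexGraph.Adj v w}.Finite := by
  refine Set.Finite.subset (Set.toFinite ({bv (row v) (pos v + 1), bv (row v) (pos v - 1),
    bv (row v - 1) (pos v), bv (row v + 1) (pos v)} : Set HexVertex)) ?_
  intro w hw
  simp only [Set.mem_setOf_eq] at hw
  rw [adj_iff] at hw
  have e := bv_row_pos w
  simp only [Set.mem_insert_iff, Set.mem_singleton_iff]
  rcases hw with ⟨h1, h2 | h2⟩ | ⟨h1, h2, -⟩ | ⟨h1, h2, -⟩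
  · left; rw [← e, h2, h1]
  · right; left; rw [← e, h2, h1]
  · right; right; left; rw [← e, h2, h1]
  · right; right; right; rw [← e, h2, h1]

/-- The mid-edges of a finite domain form a finite set (so the crux's `finsum` is a true sum). -/
theorem hexDomainMidEdges_finite (Λ : Finset HexVertex) : (hexDomainMidEdges Λ).Finite := by
  have hsub : hexDomainMidEdges Λ ⊆
      ⋃ v ∈ (↑Λ : Set HexVertex), (fun w => s(v, w)) '' {w | hexGraph.Adj v w} := by
    intro e he
    obtain ⟨he, v, hv, hvΛ⟩ := he
    induction e using Sym2.ind with
    | h x y =>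
      simp only [Set.mem_iUnion, Set.mem_image, Set.mem_setOf_eq, exists_prop]
      rw [SimpleGraph.mem_edgeSet] at he
      rcases Sym2.mem_iff.1 hv with rfl | rfl
      · exact ⟨v, hvΛ, y, he, rfl⟩
      · exact ⟨v, hvΛ, x, he.symm, Sym2.eq_swap⟩
  exact Set.Finite.subset (Set.Finite.biUnion (Finset.finite_toSet Λ) fun v _ =>
    (neighbors_finite v).image _) hsub

/-- One nonnegative term is below the `finsum` over a finite set. -/
theorem term_le_finsum_mem {E : Set (Sym2 HexVertex)} (hE : E.Finite) {f : Sym2 HexVertex → ℝ}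
    (hf : ∀ e, 0 ≤ f e) {e₀ : Sym2 HexVertex} (he₀ : e₀ ∈ E) : f e₀ ≤ ∑ᶠ e ∈ E, f e := by
  rw [finsum_mem_eq_finite_toFinset_sum f hE]
  exact Finset.single_le_sum (fun e _ => hf e) (hE.mem_toFinset.2 he₀)

theorem snd_bv_of_even {r p : ℤ} (h : (p - r) % 2 = 0) : (((bv r p).2 : ℕ) : ℝ) = 0 := by
  simp [bv, h]

theorem snd_bv_of_odd {r p : ℤ} (h : (p - r) % 2 = 1) : (((bv r p).2 : ℕ) : ℝ) = 1 := by
  simp [bv, h]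

theorem im_center_bv_even {r p : ℤ} (h : (p - r) % 2 = 0) :
    (hexCenter (bv r p)).im = hgt * ((r : ℝ) + 1 / 3) := by
  rw [hexCenter_im, snd_bv_of_even h, row_bv, hgt]; ring

theorem im_center_bv_odd {r p : ℤ} (h : (p - r) % 2 = 1) :
    (hexCenter (bv r p)).im = hgt * ((r : ℝ) + 2 / 3) := by
  rw [hexCenter_im, snd_bv_of_odd h, row_bv, hgt]; ring

theorem re_center_bv (r p : ℤ) : (hexCenter (bv r p)).re = ((p : ℝ) + 1) / 2 := by
  rw [hexCenter_re, pos_bv]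

/-- Scaled centre, real part. -/
theorem re_scaled (δ : ℝ) (v : HexVertex) :
    ((δ : ℂ) * hexCenter v).re = δ * ((pos v : ℝ) + 1) / 2 := by
  rw [Complex.re_ofReal_mul, hexCenter_re]; ring

theorem im_scaled (δ : ℝ) (v : HexVertex) :
    ((δ : ℂ) * hexCenter v).im = δ * (hexCenter v).im := by
  rw [Complex.im_ofReal_mul]

theorem im_scaled_ge (δ : ℝ) (hδ : 0 ≤ δ) (v : HexVertex) :
    δ * hgt * ((row v : ℝ) + 1 / 3) ≤ ((δ : ℂ) * hexCenter v).im := by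
  rw [im_scaled]
  have := hexCenter_im_ge v
  rw [show Real.sqrt 3 / 2 = hgt from rfl] at this
  nlinarith

theorem im_scaled_le (δ : ℝ) (hδ : 0 ≤ δ) (v : HexVertex) :
    ((δ : ℂ) * hexCenter v).im ≤ δ * hgt * ((row v : ℝ) + 2 / 3) := by
  rw [im_scaled]
  have := hexCenter_im_le v
  rw [show Real.sqrt 3 / 2 = hgt from rfl] at this
  nlinarith

/-- Components of a point of the unit ball about `b = 1 - i`. -/
theorem ball_pt1 {z : ℂ} (hz : z ∈ Metric.ball (D₀.pt 1) 1) :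
    0 < z.re ∧ z.re < 2 ∧ -2 < z.im ∧ z.im < 0 := by
  rw [Metric.mem_ball, D₀_pt1, Complex.dist_eq] at hz
  have hre := Complex.abs_re_le_norm (z - ⟨1, -1⟩)
  have him := Complex.abs_im_le_norm (z - ⟨1, -1⟩)
  simp only [Complex.sub_re, Complex.sub_im] at hre him
  rw [abs_le] at hre him
  have h1 : |(z - ⟨1, -1⟩ : ℂ).re| < 1 := lt_of_le_of_lt (Complex.abs_re_le_norm _) hz
  have h2 : |(z - ⟨1, -1⟩ : ℂ).im| < 1 := lt_of_le_of_lt (Complex.abs_im_le_norm _) hz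
  simp only [Complex.sub_re, Complex.sub_im] at h1 h2
  rw [abs_lt] at h1 h2
  refine ⟨by linarith, by linarith, by linarith, by linarith⟩

/-- `x_c < 3/5`. -/
theorem xc_lt : hexCriticalFugacity < 3 / 5 := by
  have h := hexCriticalFugacity_sq
  have h0 := hexCriticalFugacity_pos_lt_one.1
  have hs : (1 : ℝ) < Real.sqrt 2 := by
    rw [show (1:ℝ) = Real.sqrt 1 by simp]
    exact Real.sqrt_lt_sqrt (by norm_num) (by norm_num)
  nlinarith

/-- Bernoulli: `x^n ≤ 3/(2n)` for `0 < x ≤ 3/5` and `n ≥ 1`. -/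
theorem pow_le_of_bernoulli {x : ℝ} (hx0 : 0 < x) (hx1 : x ≤ 3 / 5) (n : ℕ) (hn : 1 ≤ n) :
    x ^ n ≤ 3 / (2 * n) := by
  have hinv : 2 / 3 ≤ 1 / x - 1 := by
    have : 5 / 3 ≤ 1 / x := by
      rw [le_div_iff₀ hx0]; linarith
    linarith
  have hb := one_add_mul_le_pow (a := 1 / x - 1) (by linarith) n
  have hxn : (1 / x) ^ n = 1 / x ^ n := by rw [one_div_pow]
  rw [show 1 + (1 / x - 1) = 1 / x by ring, hxn] at hb
  have hn' : (1:ℝ) ≤ n := by exact_mod_cast hn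
  have hpos : 0 < x ^ n := pow_pos hx0 n
  rw [le_div_iff₀ (by positivity)]
  have : (n : ℝ) * (2 / 3) ≤ 1 / x ^ n := by nlinarith
  rw [le_div_iff₀ hpos] at this
  nlinarith

/-- **Endgame.** An eventual inequality `δ² x^ℓ ≤ C δ^{-3/4} x^{ℓ+N}` with `N ≥ 4n`,
`n ≥ 1/(6δ)` is impossible: the right-hand side is `O(δ^{-3/4}·δ⁴)`. -/
theorem endgame {x : ℝ} (hx0 : 0 < x) (hx1 : x ≤ 3 / 5) (C : ℝ) (ℓ N n : ℝ → ℕ)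
    (hev : ∀ᶠ δ in nhdsWithin 0 (Set.Ioi 0),
      δ ^ 2 * x ^ (ℓ δ) ≤ C * δ ^ (-(3:ℝ) / 4) * x ^ (ℓ δ + N δ))
    (hN : ∀ᶠ δ in nhdsWithin 0 (Set.Ioi 0), 4 * n δ ≤ N δ ∧ 1 / (6 * δ) ≤ (n δ : ℝ)) : False := by
  set ε₀ : ℝ := min 1 (1 / (6561 * |C| + 1)) with hε₀
  have hε₀pos : 0 < ε₀ := lt_min one_pos (by positivity)
  have hsmall : ∀ᶠ δ in nhdsWithin 0 (Set.Ioi 0), 0 < δ ∧ δ < ε₀ := by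
    filter_upwards [Ioo_mem_nhdsGT hε₀pos] with δ hδ using ⟨hδ.1, hδ.2⟩
  obtain ⟨δ, ⟨hδ0, hδε⟩, hineq, hNn, hn⟩ := (hsmall.and (hev.and hN)).exists
  have hδ1 : δ ≤ 1 := le_trans hδε.le (min_le_left _ _)
  have hx1' : x ≤ 1 := by linarith
  -- positivity of the left-hand side
  have hL : 0 < δ ^ 2 * x ^ (ℓ δ) := by positivity
  -- the sign of `C`
  have hrpow_pos : 0 < δ ^ (-(3:ℝ) / 4) := Real.rpow_pos_of_pos hδ0 _
  by_cases hC' : C < 0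
  · have : C * δ ^ (-(3:ℝ) / 4) * x ^ (ℓ δ + N δ) < 0 := by
      have h1 : C * δ ^ (-(3:ℝ) / 4) < 0 := mul_neg_of_neg_of_pos hC' hrpow_pos
      exact mul_neg_of_neg_of_pos h1 (by positivity)
    linarith
  have hC : 0 ≤ C := not_lt.1 hC'
  -- `δ^{-3/4} ≤ δ⁻¹`
  have hrpow : δ ^ (-(3:ℝ) / 4) ≤ δ⁻¹ := by
    rw [← Real.rpow_neg_one]
    exact Real.rpow_le_rpow_of_exponent_ge hδ0 hδ1 (by norm_num)
  -- `x^N ≤ (x^n)^4 ≤ (9δ)^4`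
  have hn1 : 1 ≤ n δ := by
    have : (0:ℝ) < n δ := lt_of_lt_of_le (by positivity) hn
    exact_mod_cast this
  have hxn : x ^ (n δ) ≤ 9 * δ := by
    have h := pow_le_of_bernoulli hx0 hx1 (n δ) hn1
    have hnpos : (0:ℝ) < n δ := by exact_mod_cast hn1
    calc x ^ (n δ) ≤ 3 / (2 * n δ) := h
      _ ≤ 3 / (2 * (1 / (6 * δ))) := by
        apply div_le_div_of_nonneg_left (by norm_num) (by positivity)
        nlinarith
      _ = 9 * δ := by field_simp; ring
  have hxN : x ^ (N δ) ≤ (9 * δ) ^ 4 := by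
    calc x ^ (N δ) ≤ x ^ (4 * n δ) := pow_le_pow_of_le_one hx0.le hx1' hNn
      _ = (x ^ (n δ)) ^ 4 := by rw [pow_mul']
      _ ≤ (9 * δ) ^ 4 := pow_le_pow_left₀ (by positivity) hxn 4
  -- combine
  have key : δ ^ 2 * x ^ (ℓ δ) ≤ C * δ⁻¹ * (x ^ (ℓ δ) * (9 * δ) ^ 4) := by
    calc δ ^ 2 * x ^ (ℓ δ) ≤ C * δ ^ (-(3:ℝ) / 4) * x ^ (ℓ δ + N δ) := hineq
      _ = C * δ ^ (-(3:ℝ) / 4) * (x ^ (ℓ δ) * x ^ (N δ)) := by rw [pow_add]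
      _ ≤ C * δ⁻¹ * (x ^ (ℓ δ) * (9 * δ) ^ 4) := by
        apply mul_le_mul (mul_le_mul_of_nonneg_left hrpow hC) _ (by positivity) (by positivity)
        exact mul_le_mul_of_nonneg_left hxN (by positivity)
  -- divide by `x^ℓ δ²`: `1 ≤ 6561 C δ`
  have hxl : 0 < x ^ (ℓ δ) := by positivity
  have key2 : δ ^ 2 ≤ C * δ⁻¹ * (9 * δ) ^ 4 := by
    have key' : δ ^ 2 * x ^ (ℓ δ) ≤ C * δ⁻¹ * (9 * δ) ^ 4 * x ^ (ℓ δ) := by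
      calc δ ^ 2 * x ^ (ℓ δ) ≤ C * δ⁻¹ * (x ^ (ℓ δ) * (9 * δ) ^ 4) := key
        _ = C * δ⁻¹ * (9 * δ) ^ 4 * x ^ (ℓ δ) := by ring
    exact le_of_mul_le_mul_right key' hxl
  have key3 : 1 ≤ 6561 * C * δ := by
    have h9 : C * δ⁻¹ * (9 * δ) ^ 4 = 6561 * C * δ * δ ^ 2 := by field_simp; ring
    rw [h9] at key2
    have hδ2 : 0 < δ ^ 2 := by positivity
    by_contra hcon
    have hcon' : 6561 * C * δ < 1 := not_le.1 hcon
    nlinarith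
  -- but `δ < 1/(6561 |C| + 1)`
  have hδs : δ < 1 / (6561 * |C| + 1) := lt_of_lt_of_le hδε (min_le_right _ _)
  rw [abs_of_nonneg hC] at hδs
  rw [lt_div_iff₀ (by positivity)] at hδs
  nlinarith


theorem mid_re (u v : HexVertex) : (hexMidpoint s(u, v)).re = ((pos u : ℝ) + pos v + 2) / 4 := by
  rw [hexMidpoint_mk, Complex.div_ofNat_re, Complex.add_re, hexCenter_re, hexCenter_re]; ring

theorem mid_im (u v : HexVertex) :
    (hexMidpoint s(u, v)).im = ((hexCenter u).im + (hexCenter v).im) / 2 := by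
  rw [hexMidpoint_mk, Complex.div_ofNat_im, Complex.add_im]

/-- A compact subset of the open rectangle keeps a positive distance from its sides. -/
theorem compact_box {K : Set ℂ} (hK : IsCompact K) (hKD : K ⊆ D₀.carrier) :
    ∃ ε > 0, ∀ z ∈ K, (-2 + ε < z.re ∧ z.re < 2 - ε) ∧ (-1 + ε < z.im ∧ z.im < 1 - ε) := by
  obtain ⟨ε, hε, hsub⟩ := hK.exists_cthickening_subset_open D₀.isOpen hKD
  refine ⟨ε, hε, fun z hz => ?_⟩
  have h1 : ∀ w : ℂ, ‖w‖ ≤ ε → z + w ∈ D₀.carrier := fun w hw =>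
    hsub (Metric.mem_cthickening_of_dist_le (z + w) z ε K hz (by simpa [dist_eq_norm] using hw))
  have e1 := (mem_D₀_carrier.1 (h1 (ε : ℂ) (by simp [abs_of_pos hε])))
  have e2 := (mem_D₀_carrier.1 (h1 (-(ε : ℂ)) (by simp [abs_of_pos hε])))
  have e3 := (mem_D₀_carrier.1 (h1 ((ε : ℂ) * Complex.I) (by simp [abs_of_pos hε])))
  have e4 := (mem_D₀_carrier.1 (h1 (-((ε : ℂ) * Complex.I)) (by simp [abs_of_pos hε])))
  simp only [Complex.add_re, Complex.add_im, Complex.ofReal_re, Complex.ofReal_im, Complex.neg_re,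
    Complex.neg_im, Complex.mul_re, Complex.mul_im, Complex.I_re, Complex.I_im] at e1 e2 e3 e4
  refine ⟨⟨by linarith [e2.1.1], by linarith [e1.1.2]⟩, by linarith [e4.2.1], by linarith [e3.2.2]⟩

/-! ## §F. Lattice rectangles, the root and marked mid-edges `aE`, `bE` -/

/-- lattice rectangle `rows [r₁, r₂] × positions [p₁, p₂]` -/
noncomputable def Rect (r₁ r₂ p₁ p₂ : ℤ) : Finset HexVertex :=
  ((Finset.Icc r₁ r₂) ×ˢ (Finset.Icc p₁ p₂)).image fun rp => bv rp.1 rp.2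

theorem mem_Rect {r₁ r₂ p₁ p₂ : ℤ} {v : HexVertex} :
    v ∈ Rect r₁ r₂ p₁ p₂ ↔ r₁ ≤ row v ∧ row v ≤ r₂ ∧ p₁ ≤ pos v ∧ pos v ≤ p₂ := by
  simp only [Rect, Finset.mem_image, Finset.mem_product, Finset.mem_Icc, Prod.exists]
  constructor
  · rintro ⟨r, p, ⟨⟨h1, h2⟩, h3, h4⟩, rfl⟩
    simp only [row_bv, pos_bv]; exact ⟨h1, h2, h3, h4⟩
  · rintro ⟨h1, h2, h3, h4⟩
    exact ⟨row v, pos v, ⟨⟨h1, h2⟩, h3, h4⟩, bv_row_pos v⟩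

theorem bv_mem_Rect {r₁ r₂ p₁ p₂ r p : ℤ} :
    bv r p ∈ Rect r₁ r₂ p₁ p₂ ↔ r₁ ≤ r ∧ r ≤ r₂ ∧ p₁ ≤ p ∧ p ≤ p₂ := by
  rw [mem_Rect, row_bv, pos_bv]


/-- the root mid-edge `a_δ`: the vertical boundary mid-edge below `(m_δ, pA_δ)` -/
noncomputable def aE (δ : ℝ) : Sym2 HexVertex := s(bv (mRow δ - 1) (pA δ), bv (mRow δ) (pA δ))

/-- the marked boundary mid-edge `b_δ` of the rows family: the vertical mid-edge below
`(m_δ, pB_δ)` -/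
noncomputable def bE (δ : ℝ) : Sym2 HexVertex := s(bv (mRow δ) (pB δ), bv (mRow δ - 1) (pB δ))

section RowsFamily

variable {δ : ℝ}

theorem adj_aE (δ : ℝ) : hexGraph.Adj (bv (mRow δ - 1) (pA δ)) (bv (mRow δ) (pA δ)) := by
  rw [adj_bv_iff]; right; right
  have := pA_mod δ
  exact ⟨rfl, by ring, by omega⟩

theorem adj_bE (δ : ℝ) : hexGraph.Adj (bv (mRow δ - 1) (pB δ)) (bv (mRow δ) (pB δ)) := by
  rw [adj_bv_iff]; right; right
  have := pB_mod δ
  exact ⟨rfl, by ring, by omega⟩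

/-- The scaled root mid-edge: `δ·mid(a_δ) = (δ(pA+1)/2, δ·hgt·m)`. -/
theorem scaled_aE (δ : ℝ) : (δ : ℂ) * hexMidpoint (aE δ) =
    ⟨δ * ((pA δ : ℝ) + 1) / 2, δ * hgt * (mRow δ : ℝ)⟩ := by
  have hodd : (pA δ - (mRow δ - 1)) % 2 = 1 := by have := pA_mod δ; omega
  apply Complex.ext
  · rw [Complex.re_ofReal_mul, aE, mid_re, pos_bv, pos_bv]; simp; ring
  · rw [Complex.im_ofReal_mul, aE, mid_im, im_center_bv_odd hodd, im_center_bv_even (pA_mod δ)]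
    simp; ring

theorem scaled_bE (δ : ℝ) : (δ : ℂ) * hexMidpoint (bE δ) =
    ⟨δ * ((pB δ : ℝ) + 1) / 2, δ * hgt * (mRow δ : ℝ)⟩ := by
  have hodd : (pB δ - (mRow δ - 1)) % 2 = 1 := by have := pB_mod δ; omega
  apply Complex.ext
  · rw [Complex.re_ofReal_mul, bE, mid_re, pos_bv, pos_bv]; simp; ring
  · rw [Complex.im_ofReal_mul, bE, mid_im, im_center_bv_odd hodd, im_center_bv_even (pB_mod δ)]
    simp; ring

theorem tendsto_cmul (c : ℝ) :
    Filter.Tendsto (fun δ : ℝ => c * δ) (nhdsWithin 0 (Set.Ioi 0)) (nhds 0) := by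
  have : Filter.Tendsto (fun δ : ℝ => c * δ) (nhds 0) (nhds (c * 0)) := Filter.tendsto_id.const_mul c
  rw [mul_zero] at this
  exact this.mono_left nhdsWithin_le_nhds

theorem tendsto_two_mul : Filter.Tendsto (fun δ : ℝ => 2 * δ) (nhdsWithin 0 (Set.Ioi 0)) (nhds 0) :=
  tendsto_cmul 2

theorem tendsto_aE : Filter.Tendsto (fun δ : ℝ => (δ : ℂ) * hexMidpoint (aE δ))
    (nhdsWithin 0 (Set.Ioi 0)) (nhds (D₀.pt 0)) := by
  rw [D₀_pt0, tendsto_iff_dist_tendsto_zero]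
  refine squeeze_zero' (Filter.Eventually.of_forall fun δ => dist_nonneg) ?_ tendsto_two_mul
  filter_upwards [self_mem_nhdsWithin] with δ hδ
  rw [Set.mem_Ioi] at hδ
  rw [scaled_aE, Complex.dist_eq]
  refine (Complex.norm_le_abs_re_add_abs_im _).trans ?_
  simp only [Complex.sub_re, Complex.sub_im]
  obtain ⟨h1, h2⟩ := pA_re hδ
  have h3 := mRow_height hδ
  have h4 := mRow_height' hδ
  have hg := hgt_pos
  have hg' := hgt_lt
  have k1 : δ * hgt ≤ δ := by nlinarith
  have e1 : |δ * ((pA δ : ℝ) + 1) / 2 - -1| ≤ δ := abs_le.2 ⟨by linarith, by linarith⟩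
  have e2 : |δ * hgt * (mRow δ : ℝ) - -1| ≤ δ := abs_le.2 ⟨by linarith, by linarith⟩
  linarith

theorem tendsto_bE : Filter.Tendsto (fun δ : ℝ => (δ : ℂ) * hexMidpoint (bE δ))
    (nhdsWithin 0 (Set.Ioi 0)) (nhds (D₀.pt 1)) := by
  rw [D₀_pt1, tendsto_iff_dist_tendsto_zero]
  refine squeeze_zero' (Filter.Eventually.of_forall fun δ => dist_nonneg) ?_ tendsto_two_mul
  filter_upwards [self_mem_nhdsWithin] with δ hδ
  rw [Set.mem_Ioi] at hδ
  rw [scaled_bE, Complex.dist_eq]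
  refine (Complex.norm_le_abs_re_add_abs_im _).trans ?_
  simp only [Complex.sub_re, Complex.sub_im]
  obtain ⟨h1, h2⟩ := pB_re hδ
  have h3 := mRow_height hδ
  have h4 := mRow_height' hδ
  have hg := hgt_pos
  have hg' := hgt_lt
  have k1 : δ * hgt ≤ δ := by nlinarith
  have e1 : |δ * ((pB δ : ℝ) + 1) / 2 - 1| ≤ δ := abs_le.2 ⟨by linarith, by linarith⟩
  have e2 : |δ * hgt * (mRow δ : ℝ) - -1| ≤ δ := abs_le.2 ⟨by linarith, by linarith⟩
  linarith

end RowsFamily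


/-! ## §N1. Root corridors with an exit: every walk to a far target first traverses the corridor -/

section RootCorridor

variable {Λ Λ' : Finset HexVertex} {u h : HexVertex} {c : ℕ → HexVertex} {L : ℕ}
  {z : Sym2 HexVertex}

/-- **Corridor prefix.** Root mid-edge `s(u, c 0)` (`u ∉ Λ`), a bare corridor `c 0, …, c L` of `Λ`
whose only `Λ`-neighbours are corridor neighbours, except that `c L` has one more neighbour, the
exit `h`. A self-avoiding walk from the root to a mid-edge `z` avoiding the corridor vertices
visits `c 0, …, c L, h` first, in this order. -/
theorem corridor_prefix (hu : u ∉ Λ)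
    (hbare : ∀ i, i ≤ L → ∀ v ∈ Λ, hexGraph.Adj (c i) v →
      (1 ≤ i ∧ v = c (i - 1)) ∨ (i < L ∧ v = c (i + 1)) ∨ (i = L ∧ v = h))
    (hz : ∀ i, i ≤ L → c i ∉ z) (γ : HexMidEdgeSAW Λ s(u, c 0) z) :
    L + 2 ≤ γ.verts.length ∧
      ∀ j (hj : j < γ.verts.length), (j ≤ L → γ.verts[j] = c j) ∧ (j = L + 1 → γ.verts[j] = h) := by
  set l := γ.verts with hl
  have hne : l ≠ [] := fun h0 => hz 0 (Nat.zero_le _) (by rw [← γ.eq_of_nil h0]; exact Sym2.mem_mk_right _ _)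
  have hn : 0 < l.length := List.length_pos_iff.2 hne
  have hmemΛ : ∀ (i : ℕ) (hi : i < l.length), l[i] ∈ Λ := fun i hi => γ.subset _ (List.getElem_mem _)
  have h0 : l[0] = c 0 := by
    have hmem := γ.head_mem (l.head hne) (List.head?_eq_some_head hne)
    rw [List.head_eq_getElem] at hmem
    rcases Sym2.mem_iff.1 hmem with h' | h'
    · exact absurd (h' ▸ hmemΛ 0 hn) hu
    · exact h'
  have hchain : ∀ (i : ℕ) (hi : i + 1 < l.length), hexGraph.Adj l[i] l[i + 1] :=
    fun i hi => List.isChain_iff_getElem.1 γ.isChain i hi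
  have hnod : ∀ (i j : ℕ) (hi : i < l.length) (hj : j < l.length), l[i] = l[j] → i = j :=
    fun i j hi hj h' => (γ.nodup.getElem_inj_iff).1 h'
  -- the prefix
  have claimA : ∀ j (hj : j < l.length), j ≤ L → l[j] = c j := by
    intro j
    induction j using Nat.strong_induction_on with
    | _ j ih =>
      intro hj hjL
      match j with
      | 0 => exact h0
      | j + 1 =>
        have hprev : l[j] = c j := ih j (by omega) (by omega) (by omega)
        have hadj : hexGraph.Adj (c j) l[j + 1] := by
          have := hchain j hj
          rwa [hprev] at this
        rcases hbare j (by omega) _ (hmemΛ _ hj) hadj with ⟨hj1, h'⟩ | ⟨-, h'⟩ | ⟨hjL', -⟩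
        · exfalso
          have hpp : l[j - 1] = c (j - 1) := ih (j - 1) (by omega) (by omega) (by omega)
          have : l[j + 1] = l[j - 1] := by rw [h', hpp]
          have := hnod _ _ hj (by omega) this
          omega
        · exact h'
        · omega
  -- the walk is longer than the corridor
  have hlen : L + 2 ≤ l.length := by
    by_contra hlt
    have hlast := γ.getLast_mem (l.getLast hne) (List.getLast?_eq_some_getLast hne)
    rw [List.getLast_eq_getElem] at hlast
    have heq : l[l.length - 1] = c (l.length - 1) := claimA _ (by omega) (by omega)
    rw [heq] at hlast
    exact hz (l.length - 1) (by omega) hlast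
  refine ⟨hlen, fun j hj => ⟨claimA j hj, fun hjL => ?_⟩⟩
  subst hjL
  have hL : l[L] = c L := claimA L (by omega) le_rfl
  have hadj : hexGraph.Adj (c L) l[L + 1] := by
    have := hchain L hj
    rwa [hL] at this
  rcases hbare L le_rfl _ (hmemΛ _ hj) hadj with ⟨hL1, h'⟩ | ⟨hlt, -⟩ | ⟨-, h'⟩
  · exfalso
    have hpp : l[L - 1] = c (L - 1) := claimA (L - 1) (by omega) (by omega)
    have : l[L + 1] = l[L - 1] := by rw [h', hpp]
    have := hnod _ _ (by omega) (by omega) this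
    omega
  · omega
  · exact h'

/-- **The suffix of a walk through a root corridor**, as a walk of the domain `Λ'` (any vertex
set containing the non-corridor vertices of `Λ` and missing the corridor) from the exit mid-edge
`s(c L, h)` to the same target. -/
def corridorSuffix (hu : u ∉ Λ)
    (hbare : ∀ i, i ≤ L → ∀ v ∈ Λ, hexGraph.Adj (c i) v →
      (1 ≤ i ∧ v = c (i - 1)) ∨ (i < L ∧ v = c (i + 1)) ∨ (i = L ∧ v = h))
    (hz : ∀ i, i ≤ L → c i ∉ z)
    (hΛ' : ∀ v ∈ Λ, (∀ i, i ≤ L → v ≠ c i) → v ∈ Λ') (hch : hexGraph.Adj (c L) h)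
    (γ : HexMidEdgeSAW Λ s(u, c 0) z) : HexMidEdgeSAW Λ' s(c L, h) z :=
  have key := corridor_prefix hu hbare hz γ
  have hlen : L + 2 ≤ γ.verts.length := key.1
  have hpre : ∀ j (hj : j < γ.verts.length), j ≤ L → γ.verts[j] = c j := fun j hj => (key.2 j hj).1
  have hh : γ.verts[L + 1]'(by omega) = h := (key.2 (L + 1) (by omega)).2 rfl
  have hnod : ∀ (i j : ℕ) (hi : i < γ.verts.length) (hj : j < γ.verts.length),
      γ.verts[i] = γ.verts[j] → i = j := fun i j hi hj h' => (γ.nodup.getElem_inj_iff).1 h'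
  have hrest : ∀ v ∈ γ.verts.drop (L + 1), v ∈ Λ ∧ ∀ i, i ≤ L → v ≠ c i := by
    intro v hv
    refine ⟨γ.subset v ((List.drop_sublist _ _).subset hv), fun i hi hvi => ?_⟩
    obtain ⟨k, hk, rfl⟩ := List.getElem_of_mem hv
    rw [List.getElem_drop] at hvi
    rw [← hpre i (by omega) hi] at hvi
    have := hnod _ _ (by rw [List.length_drop] at hk; omega) (by omega) hvi
    omega
  have hne : γ.verts.drop (L + 1) ≠ [] := by
    intro h0
    have := congrArg List.length h0
    rw [List.length_drop, List.length_nil] at this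
    omega
  { verts := γ.verts.drop (L + 1)
    subset := fun v hv => hΛ' v (hrest v hv).1 (hrest v hv).2
    nodup := γ.nodup.sublist (List.drop_sublist _ _)
    isChain := γ.isChain.drop _
    head_mem := by
      intro v hv
      rw [List.head?_drop, List.getElem?_eq_getElem (by omega), Option.some_inj] at hv
      rw [← hv, hh]
      exact Sym2.mem_mk_right _ _
    getLast_mem := by
      intro v hv
      rw [List.getLast?_drop, if_neg (by omega)] at hv
      exact γ.getLast_mem v hv
    eq_of_nil := fun h0 => (hne h0).elim
    edges_nodup := fun _ => by
      set l := γ.verts with hl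
      set E := List.zipWith (fun u w => s(u, w)) l l.tail with hE
      have hlne : l ≠ [] := by intro h0; rw [h0] at hlen; simp at hlen
      have hEnd := γ.edges_nodup hlne
      rw [← hE] at hEnd
      -- the new edge list is a suffix of the old one
      have hElen : E.length = l.length - 1 := by
        rw [hE, List.length_zipWith, List.length_tail]; omega
      have hR : List.zipWith (fun u w => s(u, w)) (l.drop (L + 1)) (l.drop (L + 1)).tail =
          E.drop (L + 1) := by
        rw [hE, List.drop_zipWith, List.tail_drop, List.drop_tail]
      have hh' : l[L + 1]'(by omega) = h := hh
      have hEL : (List.zipWith (fun u w => s(u, w)) l l.tail)[L]'(by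
          rw [List.length_zipWith, List.length_tail]; omega) = s(c L, h) := by
        rw [List.getElem_zipWith, List.getElem_tail, hpre L (by omega) le_rfl, hh']
      have hsuf : s(c L, h) :: List.zipWith (fun u w => s(u, w)) (l.drop (L + 1)) (l.drop (L + 1)).tail =
          E.drop L := by
        rw [hR, ← hEL, ← List.drop_eq_getElem_cons]
      rw [hsuf]
      have hsub : List.Sublist (E.drop L ++ [z]) (s(u, c 0) :: E ++ [z]) :=
        ((List.drop_sublist L E).append_right [z]).trans (List.sublist_cons_self _ _)
      exact hEnd.sublist hsub
    fst_mem := by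
      refine ⟨(SimpleGraph.mem_edgeSet _).2 hch, h, Sym2.mem_mk_right _ _, ?_⟩
      have hmem : h ∈ γ.verts.drop (L + 1) := by
        rw [← hh]
        have : γ.verts[L + 1]'(by omega) = (γ.verts.drop (L + 1))[0]'(by rw [List.length_drop]; omega) := by
          rw [List.getElem_drop]
        rw [this]; exact List.getElem_mem _
      exact hΛ' h (hrest h hmem).1 (hrest h hmem).2 }

/-- The suffix is shorter by exactly the corridor: `ℓ(γ) = (L + 1) + ℓ(suffix)`. -/
theorem corridorSuffix_length (hu : u ∉ Λ)
    (hbare : ∀ i, i ≤ L → ∀ v ∈ Λ, hexGraph.Adj (c i) v →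
      (1 ≤ i ∧ v = c (i - 1)) ∨ (i < L ∧ v = c (i + 1)) ∨ (i = L ∧ v = h))
    (hz : ∀ i, i ≤ L → c i ∉ z)
    (hΛ' : ∀ v ∈ Λ, (∀ i, i ≤ L → v ≠ c i) → v ∈ Λ') (hch : hexGraph.Adj (c L) h)
    (γ : HexMidEdgeSAW Λ s(u, c 0) z) :
    γ.length = (L + 1) + (corridorSuffix hu hbare hz hΛ' hch γ).length := by
  have hlen : L + 2 ≤ γ.verts.length := (corridor_prefix hu hbare hz γ).1
  show γ.verts.length = (L + 1) + (γ.verts.drop (L + 1)).length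
  rw [List.length_drop]; omega

/-- The suffix map is injective (the prefix is forced). -/
theorem corridorSuffix_injective (hu : u ∉ Λ)
    (hbare : ∀ i, i ≤ L → ∀ v ∈ Λ, hexGraph.Adj (c i) v →
      (1 ≤ i ∧ v = c (i - 1)) ∨ (i < L ∧ v = c (i + 1)) ∨ (i = L ∧ v = h))
    (hz : ∀ i, i ≤ L → c i ∉ z)
    (hΛ' : ∀ v ∈ Λ, (∀ i, i ≤ L → v ≠ c i) → v ∈ Λ') (hch : hexGraph.Adj (c L) h) :
    Function.Injective (corridorSuffix (z := z) hu hbare hz hΛ' hch) := by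
  intro γ₁ γ₂ heq
  have h1 := corridor_prefix hu hbare hz γ₁
  have h2 := corridor_prefix hu hbare hz γ₂
  have hd : γ₁.verts.drop (L + 1) = γ₂.verts.drop (L + 1) := congrArg HexMidEdgeSAW.verts heq
  apply HexMidEdgeSAW.ext
  apply List.ext_getElem
  · have := congrArg List.length hd
    rw [List.length_drop, List.length_drop] at this
    omega
  · intro i hi1 hi2
    by_cases hi : i ≤ L
    · rw [(h1.2 i hi1).1 hi, (h2.2 i hi2).1 hi]
    · have e1 : γ₁.verts[i] = (γ₁.verts.drop (L + 1))[i - (L + 1)]'(by rw [List.length_drop]; omega) := by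
        rw [List.getElem_drop]; congr 1; omega
      have e2 : γ₂.verts[i] = (γ₂.verts.drop (L + 1))[i - (L + 1)]'(by rw [List.length_drop]; omega) := by
        rw [List.getElem_drop]; congr 1; omega
      rw [e1, e2]
      simp only [hd]

/-- **Root-corridor transfer (inequality).** Every walk from the root to a target avoiding the
corridor pays the factor `x^{L+1}` of the corridor: `Z_Λ(a → z) ≤ x^{L+1} · Z_{Λ'}(exit → z)`. -/
theorem sum_pow_length_le_corridor (hu : u ∉ Λ)
    (hbare : ∀ i, i ≤ L → ∀ v ∈ Λ, hexGraph.Adj (c i) v →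
      (1 ≤ i ∧ v = c (i - 1)) ∨ (i < L ∧ v = c (i + 1)) ∨ (i = L ∧ v = h))
    (hz : ∀ i, i ≤ L → c i ∉ z)
    (hΛ' : ∀ v ∈ Λ, (∀ i, i ≤ L → v ≠ c i) → v ∈ Λ') (hch : hexGraph.Adj (c L) h)
    {x : ℝ} (hx : 0 ≤ x) :
    ∑ γ : HexMidEdgeSAW Λ s(u, c 0) z, x ^ γ.length ≤
      x ^ (L + 1) * ∑ γ' : HexMidEdgeSAW Λ' s(c L, h) z, x ^ γ'.length := by
  classical
  set φ := corridorSuffix (z := z) hu hbare hz hΛ' hch with hφ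
  calc ∑ γ : HexMidEdgeSAW Λ s(u, c 0) z, x ^ γ.length
      = ∑ γ : HexMidEdgeSAW Λ s(u, c 0) z, x ^ (L + 1) * x ^ (φ γ).length := by
        refine Finset.sum_congr rfl fun γ _ => ?_
        rw [← pow_add, ← corridorSuffix_length hu hbare hz hΛ' hch γ]
    _ = x ^ (L + 1) * ∑ γ : HexMidEdgeSAW Λ s(u, c 0) z, x ^ (φ γ).length := by
        rw [Finset.mul_sum]
    _ = x ^ (L + 1) * ∑ γ' ∈ (Finset.univ : Finset (HexMidEdgeSAW Λ s(u, c 0) z)).image φ,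
          x ^ γ'.length := by
        have hinj : Set.InjOn φ ↑(Finset.univ : Finset (HexMidEdgeSAW Λ s(u, c 0) z)) :=
          fun γ₁ _ γ₂ _ h' => corridorSuffix_injective hu hbare hz hΛ' hch h'
        rw [Finset.sum_image hinj]
    _ ≤ x ^ (L + 1) * ∑ γ' : HexMidEdgeSAW Λ' s(c L, h) z, x ^ γ'.length := by
        exact mul_le_mul_of_nonneg_left
          (Finset.sum_le_sum_of_subset_of_nonneg (Finset.subset_univ _) fun _ _ _ => pow_nonneg hx _)
          (pow_nonneg hx _)

/-- **The walk to a side mid-edge of a root corridor is unique**, hence `|F_σ| = x^{ℓ}` there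
for every spin `σ`: root `s(u, c 0)`, bare corridor `c 0 … c L` with exit `h` (any further vertex
of `Λ` adjacent to `c L`), target the mid-edge `s(h, y)` with `y ∉ Λ`. -/
theorem norm_obs_corridor_exit_side (hu : u ∉ Λ)
    (hbare : ∀ i, i ≤ L → ∀ v ∈ Λ, hexGraph.Adj (c i) v →
      (1 ≤ i ∧ v = c (i - 1)) ∨ (i < L ∧ v = c (i + 1)) ∨ (i = L ∧ v = h))
    {y : HexVertex} (hy : y ∉ Λ) (hzc : ∀ i, i ≤ L → c i ∉ s(h, y))
    (hcΛ : ∀ i, i ≤ L → c i ∈ Λ) (hh : h ∈ Λ)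
    (hinj : ∀ i j, i ≤ L → j ≤ L → c i = c j → i = j) (hhc : ∀ i, i ≤ L → c i ≠ h)
    (hadj : ∀ i, i < L → hexGraph.Adj (c i) (c (i + 1))) (huc : hexGraph.Adj u (c 0))
    (hch : hexGraph.Adj (c L) h) {x : ℝ} (hx : 0 ≤ x) (σ : ℝ) :
    ‖hexParafermionicObservable Λ s(u, c 0) x σ s(h, y)‖ = x ^ (L + 2) := by
  classical
  -- the corridor walk extended by the exit vertex: `E = [c 0, …, c L, h]`
  have hElen : ((List.range (L + 1)).map c ++ [h]).length = L + 2 := by simp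
  have hEget : ∀ (i : ℕ) (hi : i < ((List.range (L + 1)).map c ++ [h]).length), i ≤ L →
      ((List.range (L + 1)).map c ++ [h])[i] = c i := by
    intro i hi hiL
    rw [List.getElem_append_left (by simpa using Nat.lt_succ_of_le hiL)]
    simp
  have hElast : ∀ (hi : L + 1 < ((List.range (L + 1)).map c ++ [h]).length),
      ((List.range (L + 1)).map c ++ [h])[L + 1] = h := by
    intro hi
    rw [List.getElem_append_right (by simp)]
    simp
  have hmem_l : ∀ v ∈ (List.range (L + 1)).map c ++ [h], (∃ i, i ≤ L ∧ v = c i) ∨ v = h := by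
    intro v hv
    simp only [List.mem_append, List.mem_map, List.mem_range, List.mem_singleton] at hv
    rcases hv with ⟨i, hi, rfl⟩ | rfl
    · exact Or.inl ⟨i, by omega, rfl⟩
    · exact Or.inr rfl
  let γ₀ : HexMidEdgeSAW Λ s(u, c 0) s(h, y) := mkSAW Λ u (c 0) s(h, y)
    ((List.range (L + 1)).map c ++ [h]) (by simp)
    (by
      intro v hv
      rcases hmem_l v hv with ⟨i, hi, rfl⟩ | rfl
      · exact hcΛ i hi
      · exact hh)
    (by
      rw [List.nodup_append]
      refine ⟨List.Nodup.map_on (fun i hi j hj hij => hinj i j ?_ ?_ hij) List.nodup_range,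
        List.nodup_singleton _, ?_⟩
      · simp only [List.mem_range] at hi; omega
      · simp only [List.mem_range] at hj; omega
      · intro v hv w hw
        simp only [List.mem_map, List.mem_range] at hv
        rw [List.mem_singleton] at hw
        obtain ⟨i, hi, rfl⟩ := hv
        rw [hw]; exact hhc i (by omega))
    (by
      refine List.isChain_iff_getElem.2 ?_
      intro i hi
      by_cases hiL : i + 1 ≤ L
      · rw [hEget i (by omega) (by omega), hEget (i + 1) hi hiL]
        exact hadj i (by omega)
      · have hi' : i = L := by rw [hElen] at hi; omega
        subst hi'
        rw [hEget i (by omega) le_rfl, hElast hi]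
        exact hch)
    (by simp [List.range_succ_eq_map])
    (by simp)
    huc (hcΛ 0 (Nat.zero_le _))
    (by
      intro hul
      rcases hmem_l u hul with ⟨i, hi, hui⟩ | hui
      · exact hu (hui ▸ hcΛ i hi)
      · exact hu (hui ▸ hh))
    ⟨y, Sym2.mem_mk_right _ _, by
      intro hyl
      rcases hmem_l y hyl with ⟨i, hi, hyi⟩ | hyi
      · exact hy (hyi ▸ hcΛ i hi)
      · exact hy (hyi ▸ hh)⟩
    (by
      intro heq
      exact hzc 0 (Nat.zero_le _) (by rw [← heq]; exact Sym2.mem_mk_right _ _))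
  -- every walk is `γ₀`
  have huniq : ∀ γ : HexMidEdgeSAW Λ s(u, c 0) s(h, y), γ = γ₀ := by
    intro γ
    obtain ⟨hlen, hpre⟩ := corridor_prefix hu hbare hzc γ
    have hne : γ.verts ≠ [] := by intro h0; rw [h0] at hlen; simp at hlen
    have hnod : ∀ (i j : ℕ) (hi : i < γ.verts.length) (hj : j < γ.verts.length),
        γ.verts[i] = γ.verts[j] → i = j := fun i j hi hj h' => (γ.nodup.getElem_inj_iff).1 h'
    -- the last vertex is `h = verts[L+1]`, so the walk has length `L + 2`
    have hlast : γ.verts[γ.verts.length - 1]'(by omega) = h := by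
      have hmem := γ.getLast_mem (γ.verts.getLast hne) (List.getLast?_eq_some_getLast hne)
      rw [List.getLast_eq_getElem] at hmem
      rcases Sym2.mem_iff.1 hmem with h' | h'
      · exact h'
      · exact absurd (h' ▸ γ.subset _ (List.getElem_mem _)) hy
    have hL1 : γ.verts[L + 1]'(by omega) = h := (hpre (L + 1) (by omega)).2 rfl
    have hlen' : γ.verts.length = L + 2 := by
      have := hnod (γ.verts.length - 1) (L + 1) (by omega) (by omega) (by rw [hlast, hL1])
      omega
    apply HexMidEdgeSAW.ext
    show γ.verts = (List.range (L + 1)).map c ++ [h]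
    apply List.ext_getElem
    · rw [hlen', hElen]
    · intro i hi1 hi2
      by_cases hi : i ≤ L
      · rw [hEget i hi2 hi]
        exact (hpre i hi1).1 hi
      · have hi' : i = L + 1 := by omega
        subst hi'
        rw [hElast hi2]
        exact hL1
  letI : Unique (HexMidEdgeSAW Λ s(u, c 0) s(h, y)) := ⟨⟨γ₀⟩, huniq⟩
  rw [hexParafermionicObservable, Fintype.sum_unique, HexMidEdgeSAW.norm_weight _ hx]
  show x ^ γ₀.length = x ^ (L + 2)
  rw [mkSAW_length, hElen]

end RootCorridor


/-! ## §N2. Comparison with a Duminil-Copin–Smirnov strip: `Z_H(e₀ → b) ≤ B_{T,L} ≤ 1` -/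

section StripCompare

variable {H : Finset HexVertex} {t₀ v₀ vb tb : HexVertex} {T L' : ℕ}

/-- **Strip comparison.** If a chart `Φ` of the honeycomb lattice sends the root dart
`t₀ → v₀` (`t₀ ∉ H ∋ v₀`) to the standard entrance and the domain `H` into the strip `S_{T,L'}`,
and the target boundary mid-edge `{vb, tb}` (`tb ∉ H`) to a `β`-dart, then the mass of the walks
of `H` from `s(t₀, v₀)` to `s(vb, tb)` is at most `B_{T,L'}(x_c)`. -/
theorem sum_pow_length_le_stripB (Φ : hexGraph ≃g hvGraph) (ht₀ : t₀ ∉ H)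
    (hΦt : Φ t₀ = HV.wOut) (hΦv : Φ v₀ = hvOrigin)
    (hH : ∀ f ∈ H, Φ f ∈ HV.stripV T L') (htb : tb ∉ H) (hvtb : hexGraph.Adj vb tb)
    (hβ : HV.IsBetaDart T (Φ vb, Φ tb)) (hne : s(t₀, v₀) ≠ s(vb, tb)) :
    ∑ γ : HexMidEdgeSAW H s(t₀, v₀) s(vb, tb), hexCriticalFugacity ^ γ.length ≤
      HV.stripB T L' hexCriticalFugacity := by
  classical
  have hx0 : 0 ≤ hexCriticalFugacity := hexCriticalFugacity_pos_lt_one.1.le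
  -- every walk is nontrivial and ends at `vb`
  have hne' : ∀ γ : HexMidEdgeSAW H s(t₀, v₀) s(vb, tb), γ.verts ≠ [] :=
    fun γ h0 => hne (γ.eq_of_nil h0)
  have hlast : ∀ γ : HexMidEdgeSAW H s(t₀, v₀) s(vb, tb), γ.verts.getLast (hne' γ) = vb := by
    intro γ
    have hmem := γ.getLast_mem _ (List.getLast?_eq_some_getLast (hne' γ))
    rcases Sym2.mem_iff.1 hmem with h' | h'
    · exact h'
    · exact absurd (h' ▸ γ.subset _ (List.getLast_mem (hne' γ))) htb
  -- the coding
  set code : HexMidEdgeSAW H s(t₀, v₀) s(vb, tb) → List HV :=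
    fun γ => HV.wOut :: (γ.verts.map Φ ++ [Φ tb]) with hcode
  have hsub : H.map Φ.toEquiv.toEmbedding ⊆ HV.stripV T L' := by
    intro P hP
    rw [Finset.mem_map] at hP
    obtain ⟨f, hf, rfl⟩ := hP
    exact hH f hf
  have hmem : ∀ γ : HexMidEdgeSAW H s(t₀, v₀) s(vb, tb),
      code γ ∈ (HV.midWalks (HV.stripV T L')).filter (fun P => HV.IsBetaDart T (HV.finalDart P)) := by
    intro γ
    rw [Finset.mem_filter, HV.mem_midWalks_iff]
    refine ⟨HV.IsMidWalk.mono hsub (γ.isMidWalk_code Φ rfl ht₀ hΦt hΦv hvtb (hne' γ)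
      (e := tb) (Or.inl ⟨hlast γ, rfl⟩)), ?_⟩
    have hm : γ.verts.map Φ ≠ [] := by simpa using hne' γ
    rw [hcode]
    dsimp only
    rw [HV.finalDart_cons_append hm, List.getLast_map hm, hlast γ]
    exact hβ
  have hinj : Function.Injective code := by
    intro γ₁ γ₂ h
    rw [hcode] at h
    have h' := congrArg List.dropLast (List.cons.inj h).2
    rw [List.dropLast_concat, List.dropLast_concat] at h'
    exact HexMidEdgeSAW.ext (List.map_injective_iff.2 Φ.injective h')
  have hlen : ∀ γ : HexMidEdgeSAW H s(t₀, v₀) s(vb, tb), HV.mwLen (code γ) = γ.length := by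
    intro γ
    rw [hcode]
    dsimp only
    rw [HV.mwLen_cons_append, List.length_map]
    rfl
  calc ∑ γ : HexMidEdgeSAW H s(t₀, v₀) s(vb, tb), hexCriticalFugacity ^ γ.length
      = ∑ γ : HexMidEdgeSAW H s(t₀, v₀) s(vb, tb), hexCriticalFugacity ^ HV.mwLen (code γ) := by
        refine Finset.sum_congr rfl fun γ _ => ?_
        rw [hlen γ]
    _ = ∑ P ∈ (Finset.univ : Finset (HexMidEdgeSAW H s(t₀, v₀) s(vb, tb))).image code,
          hexCriticalFugacity ^ HV.mwLen P := by
        rw [Finset.sum_image fun γ₁ _ γ₂ _ h => hinj h]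
    _ ≤ HV.stripB T L' hexCriticalFugacity := by
        refine Finset.sum_le_sum_of_subset_of_nonneg ?_ fun _ _ _ => pow_nonneg hx0 _
        intro P hP
        rw [Finset.mem_image] at hP
        obtain ⟨γ, -, rfl⟩ := hP
        exact hmem γ

/-- … hence at most `1` (Duminil-Copin–Smirnov Lemma 2). -/
theorem sum_pow_length_le_one (Φ : hexGraph ≃g hvGraph) (ht₀ : t₀ ∉ H)
    (hΦt : Φ t₀ = HV.wOut) (hΦv : Φ v₀ = hvOrigin) (hT : 1 ≤ T)
    (hH : ∀ f ∈ H, Φ f ∈ HV.stripV T L') (htb : tb ∉ H) (hvtb : hexGraph.Adj vb tb)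
    (hβ : HV.IsBetaDart T (Φ vb, Φ tb)) (hne : s(t₀, v₀) ≠ s(vb, tb)) :
    ∑ γ : HexMidEdgeSAW H s(t₀, v₀) s(vb, tb), hexCriticalFugacity ^ γ.length ≤ 1 :=
  (sum_pow_length_le_stripB Φ ht₀ hΦt hΦv hH htb hvtb hβ hne).trans
    (stripB_le_one_of_lemma2 DuminilCopinSmirnov2012_lemma2_holds hT L')

end StripCompare


/-! ## §N3. The corridor-through-`K` family: parameters -/

section Params2

variable {δ : ℝ}

/-- number of rising row-steps of the corridor (apex at height `≈ 0.9`) -/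
noncomputable def NA (δ : ℝ) : ℕ := ⌊19 * (1 / (δ * hgt)) / 10⌋₊
/-- top row of the block `H` at `b` (height `≈ 0.3`) -/
noncomputable def MT (δ : ℝ) : ℤ := ⌊3 * (1 / (δ * hgt)) / 10⌋
/-- index of the rising row carrying the `K`-edge (height `≈ 0`) -/
noncomputable def iK2 (δ : ℝ) : ℕ := ⌊1 / (δ * hgt)⌋₊
/-- apex row -/
noncomputable def RA (δ : ℝ) : ℤ := mRow δ + NA δ
/-- apex position (last rising column) -/
noncomputable def qA (δ : ℝ) : ℤ := pA δ + NA δ + 1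
/-- number of descending row-steps -/
noncomputable def iD (δ : ℝ) : ℕ := (RA δ - MT δ - 1).toNat
/-- index of the last corridor vertex -/
noncomputable def Jc (δ : ℝ) : ℕ := 2 * NA δ + 2 * iD δ + 2
/-- landing column: the corridor drops from `(MT + 1, pstar)` onto `h₀ = (MT, pstar) ∈ H` -/
noncomputable def pstar (δ : ℝ) : ℤ := qA δ + iD δ + 1

theorem NA_le (hδ : 0 < δ) : (NA δ : ℝ) ≤ 19 * (1 / (δ * hgt)) / 10 := by
  have h := Nat.floor_le (show (0:ℝ) ≤ 19 * (1 / (δ * hgt)) / 10 by have := hgt_pos; positivity)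
  unfold NA; exact h

theorem lt_NA (δ : ℝ) : 19 * (1 / (δ * hgt)) / 10 - 1 < (NA δ : ℝ) := by
  have h := Nat.lt_floor_add_one (19 * (1 / (δ * hgt)) / 10)
  unfold NA; linarith

theorem MT_le (δ : ℝ) : (MT δ : ℝ) ≤ 3 * (1 / (δ * hgt)) / 10 := by
  unfold MT; exact Int.floor_le _

theorem lt_MT (δ : ℝ) : 3 * (1 / (δ * hgt)) / 10 - 1 < (MT δ : ℝ) := by
  have h := Int.lt_floor_add_one (3 * (1 / (δ * hgt)) / 10)
  unfold MT; linarith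

theorem iK2_le (hδ : 0 < δ) : (iK2 δ : ℝ) ≤ 1 / (δ * hgt) := by
  have h := Nat.floor_le (show (0:ℝ) ≤ 1 / (δ * hgt) by have := hgt_pos; positivity)
  unfold iK2; exact h

theorem lt_iK2 (δ : ℝ) : 1 / (δ * hgt) - 1 < (iK2 δ : ℝ) := by
  have h := Nat.lt_floor_add_one (1 / (δ * hgt))
  unfold iK2; linarith

/-- Integer bookkeeping of the family, valid for `0 < δ ≤ 1/100`. -/
theorem params2 (hδ : 0 < δ) (hδ1 : δ ≤ 1 / 100) :
    mRow δ ≤ -10 ∧ pA δ ≤ -10 ∧ 10 ≤ pB δ ∧ pB δ ≤ PPos δ ∧ (100 : ℤ) ≤ PPos δ ∧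
    (10 : ℤ) ≤ MT δ ∧ MT δ + 3 ≤ RA δ ∧ pA δ + (MT δ - mRow δ) ≤ -8 ∧
    (1 : ℤ) ≤ qA δ ∧ pstar δ + 3 ≤ pB δ ∧ -PPos δ ≤ pA δ - 4 ∧
    ((2 * iK2 δ + 1 : ℕ) : ℤ) ≤ 2 * (NA δ : ℤ) + 1 ∧
    4 * ((iK δ / 2 : ℕ) : ℤ) + ((2 * iK2 δ + 1 : ℕ) : ℤ) ≤ (Jc δ : ℤ) + 1 ∧
    1 / (6 * δ) ≤ ((iK δ / 2 : ℕ) : ℝ) ∧ (RA δ - MT δ - 1 : ℤ) = (iD δ : ℤ) := by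
  have ht := t_ge hδ hδ1
  have hs := s_eq hδ
  set t := 1 / (δ * hgt) with ht_def
  set s := 1 / δ with hs_def
  have hg1 := hgt_gt
  have hg2 := hgt_lt
  have ht0 : 0 ≤ t := by linarith
  have hs_lo : 17 / 20 * t ≤ s := by rw [hs]; exact mul_le_mul_of_nonneg_right hg1.le ht0
  have hs_hi : s ≤ 7 / 8 * t := by rw [hs]; exact mul_le_mul_of_nonneg_right hg2.le ht0
  have h1 := mRow_le δ
  have h2 := lt_mRow δ
  have h5 := le_PPos δ
  have h6 := PPos_lt δ
  have h7 := pA_le δ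
  have h8 := lt_pA δ
  have h9 := pB_le δ
  have h10 := lt_pB δ
  have h11 := iK_le' hδ
  have h12 := lt_iK' δ
  have h13 := NA_le hδ
  have h14 := lt_NA δ
  have h15 := MT_le δ
  have h16 := lt_MT δ
  have h17 := iK2_le hδ
  have h18 := lt_iK2 δ
  simp only [← ht_def, ← hs_def] at h1 h2 h5 h6 h7 h8 h9 h10 h11 h12 h13 h14 h15 h16 h17 h18
  have hdiv1 : (iK δ : ℝ) ≤ 2 * ((iK δ / 2 : ℕ) : ℝ) + 1 := by
    have : iK δ ≤ 2 * (iK δ / 2) + 1 := by omega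
    exact_mod_cast this
  have hdiv2 : 2 * ((iK δ / 2 : ℕ) : ℝ) ≤ (iK δ : ℝ) := by
    have : 2 * (iK δ / 2) ≤ iK δ := by omega
    exact_mod_cast this
  -- the integer `iD = RA - MT - 1 ≥ 0`
  have hRA : (RA δ : ℝ) = mRow δ + NA δ := by simp [RA]
  have hqA : (qA δ : ℝ) = pA δ + NA δ + 1 := by simp [qA]
  have hiD0 : (0 : ℤ) ≤ RA δ - MT δ - 1 := by
    have : (MT δ : ℝ) + 1 ≤ RA δ := by rw [hRA]; linarith
    have := (show (MT δ : ℤ) + 1 ≤ RA δ by exact_mod_cast this)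
    omega
  have hiD : (RA δ - MT δ - 1 : ℤ) = (iD δ : ℤ) := by
    rw [iD, Int.toNat_of_nonneg hiD0]
  have hiDr : (iD δ : ℝ) = RA δ - MT δ - 1 := by
    have : (((iD δ : ℕ) : ℤ) : ℝ) = ((RA δ - MT δ - 1 : ℤ) : ℝ) := by rw [hiD]
    push_cast at this
    exact this
  have hps : (pstar δ : ℝ) = pA δ + NA δ + 1 + (RA δ - MT δ - 1) + 1 := by
    have : (pstar δ : ℝ) = qA δ + (iD δ : ℝ) + 1 := by simp [pstar]
    rw [this, hqA, hiDr]
  have hJ : (Jc δ : ℝ) = 2 * NA δ + 2 * (RA δ - MT δ - 1) + 2 := by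
    have : (Jc δ : ℝ) = 2 * NA δ + 2 * (iD δ : ℝ) + 2 := by simp [Jc]
    rw [this, hiDr]
  refine ⟨?_, ?_, ?_, ?_, ?_, ?_, ?_, ?_, ?_, ?_, ?_, ?_, ?_, ?_, hiD⟩
  · have : (mRow δ : ℝ) ≤ -10 := by linarith
    exact_mod_cast this
  · have : (pA δ : ℝ) ≤ -10 := by linarith
    exact_mod_cast this
  · have : (10 : ℝ) ≤ pB δ := by linarith
    exact_mod_cast this
  · have : (pB δ : ℝ) ≤ PPos δ := by linarith
    exact_mod_cast this
  · have : (100 : ℝ) ≤ PPos δ := by linarith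
    exact_mod_cast this
  · have : (10 : ℝ) ≤ MT δ := by linarith
    exact_mod_cast this
  · have : (MT δ : ℝ) + 3 ≤ RA δ := by rw [hRA]; linarith
    exact_mod_cast this
  · have : (pA δ : ℝ) + (MT δ - mRow δ) ≤ -8 := by linarith
    exact_mod_cast this
  · have : (1 : ℝ) ≤ qA δ := by rw [hqA]; linarith
    exact_mod_cast this
  · have : (pstar δ : ℝ) + 3 ≤ pB δ := by rw [hps, hRA]; linarith
    exact_mod_cast this
  · have : -(PPos δ : ℝ) ≤ pA δ - 4 := by linarith
    exact_mod_cast this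
  · have : (((2 * iK2 δ + 1 : ℕ) : ℤ) : ℝ) ≤ ((2 * (NA δ : ℤ) + 1 : ℤ) : ℝ) := by
      push_cast; linarith
    exact_mod_cast this
  · set A : ℕ := iK δ / 2 with hA
    have : (4 * (A : ℝ) + (2 * (iK2 δ : ℝ) + 1)) ≤ (Jc δ : ℝ) + 1 := by
      rw [hJ, hRA]
      linarith
    exact_mod_cast this
  · have : 1 / (6 * δ) = s / 6 := by rw [hs_def]; ring
    rw [this]; linarith

theorem params3 (hδ : 0 < δ) (hδ1 : δ ≤ 1 / 100) :
    RA δ ≤ PPos δ ∧ -PPos δ ≤ mRow δ ∧ 1 ≤ iK2 δ ∧ pstar δ ≤ PPos δ ∧ mRow δ ≤ MT δ := by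
  have ht := t_ge hδ hδ1
  have hs := s_eq hδ
  set t := 1 / (δ * hgt) with ht_def
  set s := 1 / δ with hs_def
  have hg1 := hgt_gt
  have hg2 := hgt_lt
  have ht0 : 0 ≤ t := by linarith
  have hs_lo : 17 / 20 * t ≤ s := by rw [hs]; exact mul_le_mul_of_nonneg_right hg1.le ht0
  have hs_hi : s ≤ 7 / 8 * t := by rw [hs]; exact mul_le_mul_of_nonneg_right hg2.le ht0
  have h1 := mRow_le δ
  have h2 := lt_mRow δ
  have h5 := le_PPos δ
  have h13 := NA_le hδ
  have h15 := MT_le δ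
  have h16 := lt_MT δ
  have h18 := lt_iK2 δ
  simp only [← ht_def, ← hs_def] at h1 h2 h5 h13 h15 h16 h18
  obtain ⟨-, -, -, hbP, -, -, -, -, -, hps, -⟩ := params2 hδ hδ1
  have hRA : (RA δ : ℝ) = mRow δ + NA δ := by simp [RA]
  refine ⟨?_, ?_, ?_, by omega, ?_⟩
  · have : (RA δ : ℝ) ≤ PPos δ := by rw [hRA]; linarith
    exact_mod_cast this
  · have : -(PPos δ : ℝ) ≤ mRow δ := by linarith
    exact_mod_cast this
  · have : (1 : ℝ) ≤ iK2 δ := by linarith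
    exact_mod_cast this
  · have : (mRow δ : ℝ) ≤ MT δ := by linarith
    exact_mod_cast this

end Params2


/-! ## §N4. The family `Λfam = H ∪ Γ`: the block `H` at `b` and the corridor `Γ` from `a` through `K` -/

theorem bv_eq_bv_iff {r p r' p' : ℤ} : bv r p = bv r' p' ↔ r = r' ∧ p = p' :=
  ⟨bv_inj, fun ⟨h1, h2⟩ => by rw [h1, h2]⟩

/-- Membership predicate of the family in brick coordinates: the block `H` (rows `m … MT`,
positions `-2 … P`), the rising staircase (rows `m … RA`, positions `pA + (r-m) + {0,1}`), the
descending staircase (rows `MT+1 … RA`, positions `qA + (RA-r) + {0,1}`, the `+0` one absent on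
the apex row). -/
def InFam (δ : ℝ) (r p : ℤ) : Prop :=
  (mRow δ ≤ r ∧ r ≤ MT δ ∧ -2 ≤ p ∧ p ≤ PPos δ) ∨
  (mRow δ ≤ r ∧ r ≤ RA δ ∧ (p = pA δ + (r - mRow δ) ∨ p = pA δ + (r - mRow δ) + 1)) ∨
  (MT δ + 1 ≤ r ∧ r ≤ RA δ ∧ ((r < RA δ ∧ p = qA δ + (RA δ - r)) ∨ p = qA δ + (RA δ - r) + 1))

noncomputable instance (δ : ℝ) (r p : ℤ) : Decidable (InFam δ r p) := by
  unfold InFam; infer_instance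

/-- **The corridor-through-`K` family.** -/
noncomputable def Λfam (δ : ℝ) : Finset HexVertex :=
  (Rect (mRow δ) (RA δ) (pA δ) (PPos δ)).filter fun v => InFam δ (row v) (pos v)

/-- the block `H` at `b` -/
noncomputable def Hb (δ : ℝ) : Finset HexVertex := Rect (mRow δ) (MT δ) (-2) (PPos δ)

/-- the corridor `Γ = (cor δ 0, …, cor δ (Jc δ))`: up-right staircase from the root vertex
`(m, pA)` to the apex row `RA`, then down-right staircase to `(MT + 1, pstar)` -/
noncomputable def cor (δ : ℝ) (j : ℕ) : HexVertex :=
  if j ≤ 2 * NA δ + 1 then bv (mRow δ + ((j / 2 : ℕ) : ℤ)) (pA δ + (((j + 1) / 2 : ℕ) : ℤ))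
  else bv (mRow δ + 2 * (NA δ : ℤ) - (((j - 1) / 2 : ℕ) : ℤ))
    (pA δ + (NA δ : ℤ) + 1 + (((j - 2 * NA δ) / 2 : ℕ) : ℤ))

/-- the exit vertex `h₀ = (MT, pstar) ∈ H` below the last corridor vertex -/
noncomputable def h₀ (δ : ℝ) : HexVertex := bv (MT δ) (pstar δ)

section Family

variable {δ : ℝ}

theorem cor_rise {j : ℕ} (hj : j ≤ 2 * NA δ + 1) :
    cor δ j = bv (mRow δ + ((j / 2 : ℕ) : ℤ)) (pA δ + (((j + 1) / 2 : ℕ) : ℤ)) := by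
  simp [cor, hj]

theorem cor_desc {j : ℕ} (hj : 2 * NA δ + 2 ≤ j) :
    cor δ j = bv (mRow δ + 2 * (NA δ : ℤ) - (((j - 1) / 2 : ℕ) : ℤ))
      (pA δ + (NA δ : ℤ) + 1 + (((j - 2 * NA δ) / 2 : ℕ) : ℤ)) := by
  simp [cor, show ¬ j ≤ 2 * NA δ + 1 by omega]

theorem cor_zero : cor δ 0 = bv (mRow δ) (pA δ) := by
  rw [cor_rise (by omega)]; simp

theorem bv_mem_Λfam (hδ : 0 < δ) (hδ1 : δ ≤ 1 / 100) {r p : ℤ} :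
    bv r p ∈ Λfam δ ↔ InFam δ r p := by
  obtain ⟨hm, hpa, hpb, hbP, hP, hMT, hRA, hclear, hqA, hps, hPa, -, -, -, hiD⟩ := params2 hδ hδ1
  have hpstar : pstar δ = qA δ + iD δ + 1 := rfl
  unfold Λfam
  rw [Finset.mem_filter, bv_mem_Rect, row_bv, pos_bv]
  constructor
  · exact fun h => h.2
  · intro h
    refine ⟨?_, h⟩
    rcases h with ⟨h1, h2, h3, h4⟩ | ⟨h1, h2, h3⟩ | ⟨h1, h2, h3⟩
    · omega
    · have : qA δ = pA δ + NA δ + 1 := rfl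
      omega
    · have : qA δ = pA δ + NA δ + 1 := rfl
      omega

theorem mem_Λfam_iff (hδ : 0 < δ) (hδ1 : δ ≤ 1 / 100) {v : HexVertex} :
    v ∈ Λfam δ ↔ InFam δ (row v) (pos v) := by
  rw [← bv_row_pos v, bv_mem_Λfam hδ hδ1, row_bv, pos_bv]

theorem bv_mem_Hb {r p : ℤ} : bv r p ∈ Hb δ ↔ mRow δ ≤ r ∧ r ≤ MT δ ∧ -2 ≤ p ∧ p ≤ PPos δ :=
  bv_mem_Rect

theorem Hb_subset_Λfam (hδ : 0 < δ) (hδ1 : δ ≤ 1 / 100) : Hb δ ⊆ Λfam δ := by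
  intro v hv
  rw [← bv_row_pos v, bv_mem_Hb] at hv
  rw [← bv_row_pos v, bv_mem_Λfam hδ hδ1]
  exact Or.inl hv

/-- row and position of the corridor vertices, and the basic facts -/
theorem cor_spec (hδ : 0 < δ) (hδ1 : δ ≤ 1 / 100) {j : ℕ} (hj : j ≤ Jc δ) :
    InFam δ (row (cor δ j)) (pos (cor δ j)) ∧ ¬ (row (cor δ j) ≤ MT δ ∧ -2 ≤ pos (cor δ j)) ∧
      mRow δ ≤ row (cor δ j) := by
  obtain ⟨hm, hpa, hpb, hbP, hP, hMT, hRA, hclear, hqA, hps, hPa, -, -, -, hiD⟩ := params2 hδ hδ1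
  have hJ : Jc δ = 2 * NA δ + 2 * iD δ + 2 := rfl
  have hq : qA δ = pA δ + NA δ + 1 := rfl
  have hR : RA δ = mRow δ + NA δ := rfl
  by_cases hjr : j ≤ 2 * NA δ + 1
  · rw [cor_rise hjr, row_bv, pos_bv]
    refine ⟨Or.inr (Or.inl ⟨by omega, by omega, by omega⟩), by omega, by omega⟩
  · rw [cor_desc (by omega), row_bv, pos_bv]
    refine ⟨Or.inr (Or.inr ⟨by omega, by omega, by omega⟩), by omega, by omega⟩

theorem cor_mem (hδ : 0 < δ) (hδ1 : δ ≤ 1 / 100) {j : ℕ} (hj : j ≤ Jc δ) : cor δ j ∈ Λfam δ := by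
  rw [mem_Λfam_iff hδ hδ1]; exact (cor_spec hδ hδ1 hj).1

theorem cor_not_mem_Hb (hδ : 0 < δ) (hδ1 : δ ≤ 1 / 100) {j : ℕ} (hj : j ≤ Jc δ) :
    cor δ j ∉ Hb δ := by
  intro h
  rw [← bv_row_pos (cor δ j), bv_mem_Hb] at h
  exact (cor_spec hδ hδ1 hj).2.1 ⟨h.2.1, h.2.2.1⟩

theorem cor_inj (hδ : 0 < δ) (hδ1 : δ ≤ 1 / 100) {i j : ℕ} (_hi : i ≤ Jc δ) (_hj : j ≤ Jc δ)
    (h : cor δ i = cor δ j) : i = j := by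
  obtain ⟨hm, hpa, hpb, hbP, hP, hMT, hRA, hclear, hqA, hps, hPa, -, -, -, hiD⟩ := params2 hδ hδ1
  have hJ : Jc δ = 2 * NA δ + 2 * iD δ + 2 := rfl
  by_cases hir : i ≤ 2 * NA δ + 1 <;> by_cases hjr : j ≤ 2 * NA δ + 1
  · rw [cor_rise hir, cor_rise hjr, bv_eq_bv_iff] at h; omega
  · rw [cor_rise hir, cor_desc (by omega), bv_eq_bv_iff] at h; omega
  · rw [cor_desc (by omega), cor_rise hjr, bv_eq_bv_iff] at h; omega
  · rw [cor_desc (by omega), cor_desc (by omega), bv_eq_bv_iff] at h; omega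

theorem adj_cor {j : ℕ} (hj : j < Jc δ) :
    hexGraph.Adj (cor δ j) (cor δ (j + 1)) := by
  have hmod := pA_mod δ
  have hJ : Jc δ = 2 * NA δ + 2 * iD δ + 2 := rfl
  by_cases hjr : j + 1 ≤ 2 * NA δ + 1
  · rw [cor_rise (by omega), cor_rise hjr, adj_bv_iff]
    rcases Nat.even_or_odd j with ⟨k, rfl⟩ | ⟨k, rfl⟩
    · left; constructor <;> omega
    · right; right; refine ⟨by omega, by omega, by omega⟩
  · by_cases hj0 : j ≤ 2 * NA δ + 1
    · -- the apex step `(RA, qA) → (RA, qA + 1)`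
      have hj1 : j = 2 * NA δ + 1 := by omega
      subst hj1
      rw [cor_rise le_rfl, cor_desc (by omega), adj_bv_iff]
      left; constructor <;> omega
    · rw [cor_desc (by omega), cor_desc (by omega), adj_bv_iff]
      rcases Nat.even_or_odd j with ⟨k, rfl⟩ | ⟨k, rfl⟩
      · right; left; refine ⟨by omega, by omega, by omega⟩
      · left; constructor <;> omega

theorem cor_J : cor δ (Jc δ) = bv (MT δ + 1 + ((RA δ - MT δ - 1) - (iD δ : ℤ))) (pstar δ) := by
  have hJ : Jc δ = 2 * NA δ + 2 * iD δ + 2 := rfl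
  rw [cor_desc (by omega), bv_eq_bv_iff]
  have hps : pstar δ = pA δ + NA δ + 1 + iD δ + 1 := rfl
  have hR : RA δ = mRow δ + NA δ := rfl
  constructor <;> omega

theorem cor_J' (hδ : 0 < δ) (hδ1 : δ ≤ 1 / 100) : cor δ (Jc δ) = bv (MT δ + 1) (pstar δ) := by
  obtain ⟨-, -, -, -, -, -, -, -, -, -, -, -, -, -, hiD⟩ := params2 hδ hδ1
  rw [cor_J, hiD, sub_self, add_zero]

theorem adj_cor_h₀ (hδ : 0 < δ) (hδ1 : δ ≤ 1 / 100) : hexGraph.Adj (cor δ (Jc δ)) (h₀ δ) := by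
  have hmod := pA_mod δ
  obtain ⟨-, -, -, -, -, -, -, -, -, -, -, -, -, -, hiD⟩ := params2 hδ hδ1
  rw [cor_J' hδ hδ1, h₀, adj_bv_iff]
  have hps : pstar δ = pA δ + NA δ + 1 + iD δ + 1 := rfl
  have hR : RA δ = mRow δ + NA δ := rfl
  right; left; refine ⟨rfl, by omega, by omega⟩

theorem h₀_mem_Hb (hδ : 0 < δ) (hδ1 : δ ≤ 1 / 100) : h₀ δ ∈ Hb δ := by
  obtain ⟨hm, hpa, hpb, hbP, hP, hMT, hRA, hclear, hqA, hps, hPa, -, -, -, hiD⟩ := params2 hδ hδ1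
  rw [h₀, bv_mem_Hb]
  have hpss : pstar δ = qA δ + iD δ + 1 := rfl
  omega

theorem h₀_ne_cor (hδ : 0 < δ) (hδ1 : δ ≤ 1 / 100) {j : ℕ} (hj : j ≤ Jc δ) : cor δ j ≠ h₀ δ :=
  fun h => cor_not_mem_Hb hδ hδ1 hj (h ▸ h₀_mem_Hb hδ hδ1)

theorem cor_even {k : ℕ} (hk : k ≤ NA δ) : cor δ (2 * k) = bv (mRow δ + k) (pA δ + k) := by
  rw [cor_rise (by omega), bv_eq_bv_iff]; constructor <;> omega

theorem cor_odd {k : ℕ} (hk : k ≤ NA δ) : cor δ (2 * k + 1) = bv (mRow δ + k) (pA δ + k + 1) := by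
  rw [cor_rise (by omega), bv_eq_bv_iff]; constructor <;> omega

theorem cor_desc_even (u : ℕ) : cor δ (2 * NA δ + 1 + 2 * u) = bv (RA δ - u) (qA δ + u) := by
  have hR : RA δ = mRow δ + NA δ := rfl
  have hq : qA δ = pA δ + NA δ + 1 := rfl
  rcases Nat.eq_zero_or_pos u with rfl | hu
  · rw [cor_rise (by omega), bv_eq_bv_iff]; constructor <;> omega
  · rw [cor_desc (by omega), bv_eq_bv_iff]; constructor <;> omega

theorem cor_desc_odd (u : ℕ) : cor δ (2 * NA δ + 2 + 2 * u) = bv (RA δ - u) (qA δ + u + 1) := by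
  have hR : RA δ = mRow δ + NA δ := rfl
  have hq : qA δ = pA δ + NA δ + 1 := rfl
  rw [cor_desc (by omega), bv_eq_bv_iff]; constructor <;> omega

set_option maxHeartbeats 800000 in
/-- **Bareness of the corridor inside the family**: the `Λfam`-neighbours of `cor j` are
`cor (j ± 1)`, plus the exit `h₀` for `j = Jc`. -/
theorem cor_bare (hδ : 0 < δ) (hδ1 : δ ≤ 1 / 100) :
    ∀ i, i ≤ Jc δ → ∀ v ∈ Λfam δ, hexGraph.Adj (cor δ i) v →
      (1 ≤ i ∧ v = cor δ (i - 1)) ∨ (i < Jc δ ∧ v = cor δ (i + 1)) ∨ (i = Jc δ ∧ v = h₀ δ) := by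
  obtain ⟨hm, hpa, hpb, hbP, hP, hMT, hRA, hclear, hqA, hps, hPa, -, -, -, hiD⟩ := params2 hδ hδ1
  have hmod := pA_mod δ
  have hJ : Jc δ = 2 * NA δ + 2 * iD δ + 2 := rfl
  have hq : qA δ = pA δ + NA δ + 1 := rfl
  have hR : RA δ = mRow δ + NA δ := rfl
  have hpss : pstar δ = pA δ + NA δ + 1 + iD δ + 1 := rfl
  intro i hi v hv hadj
  have hv' : v = bv (row v) (pos v) := (bv_row_pos v).symm
  set r := row v
  set p := pos v
  rw [hv'] at hadj ⊢
  rw [hv', bv_mem_Λfam hδ hδ1] at hv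
  rw [h₀]
  unfold InFam at hv
  clear hv'
  rcases Nat.even_or_odd i with ⟨k, hk⟩ | ⟨k, hk⟩
  · -- `i = 2k`
    rw [← two_mul] at hk
    subst hk
    by_cases hkA : k ≤ NA δ
    · -- rising, even index: `cor (2k) = (m + k, pA + k)`
      rw [cor_even hkA, adj_bv_iff] at hadj
      rcases Nat.eq_zero_or_pos k with rfl | hk1
      · right
        rw [cor_odd (Nat.zero_le _), bv_eq_bv_iff, bv_eq_bv_iff]
        rcases hadj with ⟨h1, h2⟩ | ⟨h1, h2, h3⟩ | ⟨h1, h2, h3⟩ <;> omega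
      · obtain ⟨k', rfl⟩ : ∃ k', k = k' + 1 := ⟨k - 1, by omega⟩
        rw [show 2 * (k' + 1) - 1 = 2 * k' + 1 by omega, cor_odd (by omega),
          show 2 * (k' + 1) + 1 = 2 * (k' + 1) + 1 from rfl, cor_odd hkA,
          bv_eq_bv_iff, bv_eq_bv_iff, bv_eq_bv_iff]
        rcases hadj with ⟨h1, h2⟩ | ⟨h1, h2, h3⟩ | ⟨h1, h2, h3⟩ <;> omega
    · -- descending, odd `t = 2u + 1`: `i = 2NA + 2 + 2u = 2(NA + 1 + u)`
      obtain ⟨u, rfl⟩ : ∃ u, k = NA δ + 1 + u := ⟨k - NA δ - 1, by omega⟩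
      rw [show 2 * (NA δ + 1 + u) = 2 * NA δ + 2 + 2 * u by ring, cor_desc_odd u, adj_bv_iff] at hadj
      rw [show 2 * (NA δ + 1 + u) - 1 = 2 * NA δ + 1 + 2 * u by omega, cor_desc_even u,
        show 2 * (NA δ + 1 + u) + 1 = 2 * NA δ + 1 + 2 * (u + 1) by ring, cor_desc_even (u + 1),
        bv_eq_bv_iff, bv_eq_bv_iff, bv_eq_bv_iff]
      rcases hadj with ⟨h1, h2⟩ | ⟨h1, h2, h3⟩ | ⟨h1, h2, h3⟩ <;> omega
  · -- `i = 2k + 1`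
    subst hk
    by_cases hkA : k + 1 ≤ NA δ
    · -- rising, odd index, not the apex
      rw [cor_odd (by omega), adj_bv_iff] at hadj
      rw [show 2 * k + 1 - 1 = 2 * k by omega, cor_even (by omega),
        show 2 * k + 1 + 1 = 2 * (k + 1) by ring, cor_even hkA, bv_eq_bv_iff, bv_eq_bv_iff, bv_eq_bv_iff]
      rcases hadj with ⟨h1, h2⟩ | ⟨h1, h2, h3⟩ | ⟨h1, h2, h3⟩ <;> omega
    by_cases hkB : k = NA δ
    · -- the apex `cor (2NA + 1) = (RA, qA)`
      subst hkB
      rw [cor_odd le_rfl, adj_bv_iff] at hadj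
      rw [show 2 * NA δ + 1 - 1 = 2 * NA δ by omega, cor_even le_rfl,
        show 2 * NA δ + 1 + 1 = 2 * NA δ + 2 + 2 * 0 by ring, cor_desc_odd 0,
        bv_eq_bv_iff, bv_eq_bv_iff, bv_eq_bv_iff]
      rcases hadj with ⟨h1, h2⟩ | ⟨h1, h2, h3⟩ | ⟨h1, h2, h3⟩ <;> omega
    · -- descending, even `t = 2u`, `u ≥ 1`: `i = 2NA + 1 + 2u`, `k = NA + u`
      obtain ⟨u, rfl⟩ : ∃ u, k = NA δ + u := ⟨k - NA δ, by omega⟩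
      have hu1 : 1 ≤ u := by omega
      obtain ⟨u', rfl⟩ : ∃ u', u = u' + 1 := ⟨u - 1, by omega⟩
      rw [show 2 * (NA δ + (u' + 1)) + 1 = 2 * NA δ + 1 + 2 * (u' + 1) by ring,
        cor_desc_even (u' + 1), adj_bv_iff] at hadj
      rw [show 2 * (NA δ + (u' + 1)) + 1 - 1 = 2 * NA δ + 2 + 2 * u' by omega, cor_desc_odd u',
        show 2 * (NA δ + (u' + 1)) + 1 + 1 = 2 * NA δ + 2 + 2 * (u' + 1) by ring, cor_desc_odd (u' + 1),
        bv_eq_bv_iff, bv_eq_bv_iff, bv_eq_bv_iff]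
      rcases hadj with ⟨h1, h2⟩ | ⟨h1, h2, h3⟩ | ⟨h1, h2, h3⟩ <;> omega

end Family


/-! ## §N5. Admissibility of the family (everything in the frame of `MassRatio` except exhaustion) -/

section Admissible

variable {δ : ℝ}

theorem RA_height (hδ : 0 < δ) (hδ1 : δ ≤ 1 / 100) : δ * hgt * ((RA δ : ℝ) + 2 / 3) < 1 := by
  have h1 := mRow_le δ
  have h2 := NA_le hδ
  have htm := t_mul hδ
  have hg := hgt_pos
  have hg2 := hgt_lt
  have hp : 0 < δ * hgt := by positivity
  have hRA : (RA δ : ℝ) = mRow δ + NA δ := by simp [RA]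
  rw [hRA]
  have e1 : δ * hgt * (mRow δ : ℝ) ≤ -1 + 2 / 3 * (δ * hgt) := by
    have := mul_le_mul_of_nonneg_left h1 hp.le
    nlinarith
  have e2 : δ * hgt * (NA δ : ℝ) ≤ 19 / 10 := by
    have := mul_le_mul_of_nonneg_left h2 hp.le
    nlinarith
  have e3 : δ * hgt ≤ 1 / 100 := by nlinarith
  nlinarith

theorem mem_Rect_of_mem_Λfam {v : HexVertex} (hv : v ∈ Λfam δ) :
    mRow δ ≤ row v ∧ row v ≤ RA δ ∧ pA δ ≤ pos v ∧ pos v ≤ PPos δ := by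
  unfold Λfam at hv
  rw [Finset.mem_filter, ← bv_row_pos v, bv_mem_Rect] at hv
  simpa using hv.1

/-- every vertex of the family lies in `D₀` -/
theorem inside_Λfam (hδ : 0 < δ) (hδ1 : δ ≤ 1 / 100) :
    ∀ v ∈ Λfam δ, (δ : ℂ) * hexCenter v ∈ D₀.carrier := by
  intro v hv
  obtain ⟨h1, h2, h3, h4⟩ := mem_Rect_of_mem_Λfam hv
  rw [mem_D₀_carrier, re_scaled]
  have hg := hgt_pos
  have e1 := mRow_height hδ
  have e2 := RA_height hδ hδ1
  have e3 := PPos_width hδ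
  have e4 := pA_re hδ
  have i1 := im_scaled_ge δ hδ.le v
  have i2 := im_scaled_le δ hδ.le v
  have h1' : (mRow δ : ℝ) ≤ row v := by exact_mod_cast h1
  have h2' : (row v : ℝ) ≤ RA δ := by exact_mod_cast h2
  have h3' : (pA δ : ℝ) ≤ pos v := by exact_mod_cast h3
  have h4' : (pos v : ℝ) ≤ PPos δ := by exact_mod_cast h4
  have hp : 0 < δ * hgt := by positivity
  have hδ1' : δ ≤ 1 := by linarith
  refine ⟨⟨by nlinarith, by nlinarith⟩, ?_, ?_⟩
  · calc (-1 : ℝ) < δ * hgt * ((mRow δ : ℝ) + 1 / 3) := e1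
      _ ≤ δ * hgt * ((row v : ℝ) + 1 / 3) := by nlinarith
      _ ≤ _ := i1
  · calc ((δ : ℂ) * hexCenter v).im ≤ δ * hgt * ((row v : ℝ) + 2 / 3) := i2
      _ ≤ δ * hgt * ((RA δ : ℝ) + 2 / 3) := by nlinarith
      _ < 1 := e2

/-- **the rows clause** holds: in the unit ball about `b` the family is the half-lattice `row ≥ m` -/
theorem rows_Λfam (hδ : 0 < δ) (hδ1 : δ ≤ 1 / 100) :
    ∀ v : HexVertex, (δ : ℂ) * hexCenter v ∈ Metric.ball (D₀.pt 1) 1 →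
      (v ∈ Λfam δ ↔ mRow δ ≤ v.1 1) := by
  obtain ⟨hm, hpa, hpb, hbP, hP, hMT, -⟩ := params2 hδ hδ1
  intro v hv
  obtain ⟨h1, h2, h3, h4⟩ := ball_pt1 hv
  change _ ↔ mRow δ ≤ row v
  constructor
  · exact fun h => (mem_Rect_of_mem_Λfam h).1
  · intro hmr
    rw [re_scaled] at h1 h2
    have i1 := im_scaled_ge δ hδ.le v
    have hg := hgt_pos
    have hp : 0 < δ * hgt := by positivity
    have hrow : (row v : ℝ) + 1 / 3 < 0 := by
      by_contra hcon
      have : 0 ≤ δ * hgt * ((row v : ℝ) + 1 / 3) := mul_nonneg hp.le (not_lt.1 hcon)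
      linarith
    have hrow' : row v ≤ MT δ := by
      have : (row v : ℝ) < 0 := by linarith
      have : row v < 0 := by exact_mod_cast this
      omega
    have hpos1 : 0 ≤ pos v := by
      have : (0 : ℝ) < (pos v : ℝ) + 1 := by
        by_contra hcon
        have : δ * ((pos v : ℝ) + 1) ≤ 0 := mul_nonpos_of_nonneg_of_nonpos hδ.le (not_lt.1 hcon)
        linarith
      have : (-1 : ℝ) < pos v := by linarith
      have : -1 < pos v := by exact_mod_cast this
      omega
    have hpos2 : pos v ≤ PPos δ := by
      have hlt : (pos v : ℝ) + 1 < 4 / δ := by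
        rw [lt_div_iff₀ hδ]; nlinarith
      have : (pos v : ℝ) < 4 * (1 / δ) - 1 := by rw [show 4 * (1 / δ) = 4 / δ by ring]; linarith
      have := Int.lt_ceil.2 this
      unfold PPos; omega
    rw [mem_Λfam_iff hδ hδ1]
    exact Or.inl ⟨hmr, hrow', by omega, hpos2⟩

theorem aE_eq_cor : aE δ = s(bv (mRow δ - 1) (pA δ), cor δ 0) := by
  rw [aE, cor_zero]

theorem below_not_mem {r p : ℤ} (hr : r < mRow δ) :
    bv r p ∉ Λfam δ := fun h => by
  have := (mem_Rect_of_mem_Λfam h).1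
  rw [row_bv] at this; omega

theorem aE_mem_boundary_fam (hδ : 0 < δ) (hδ1 : δ ≤ 1 / 100) :
    aE δ ∈ hexDomainBoundary (Λfam δ) := by
  refine ⟨(SimpleGraph.mem_edgeSet _).2 (adj_aE δ), bv (mRow δ - 1) (pA δ), bv (mRow δ) (pA δ),
    rfl, ?_, below_not_mem (by omega)⟩
  rw [← cor_zero]; exact cor_mem hδ hδ1 (Nat.zero_le _)

theorem bv_pB_mem_Hb (hδ : 0 < δ) (hδ1 : δ ≤ 1 / 100) : bv (mRow δ) (pB δ) ∈ Hb δ := by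
  obtain ⟨hm, hpa, hpb, hbP, hP, hMT, -⟩ := params2 hδ hδ1
  rw [bv_mem_Hb]; omega

theorem bE_mem_boundary_fam (hδ : 0 < δ) (hδ1 : δ ≤ 1 / 100) :
    bE δ ∈ hexDomainBoundary (Λfam δ) := by
  refine ⟨(SimpleGraph.mem_edgeSet _).2 (adj_bE δ).symm, bv (mRow δ - 1) (pB δ), bv (mRow δ) (pB δ),
    Sym2.eq_swap, Hb_subset_Λfam hδ hδ1 (bv_pB_mem_Hb hδ hδ1), below_not_mem (by omega)⟩

end Admissible


/-! ### Connectivity of the family, and the `Nonempty` clause -/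

section Connected

variable {δ : ℝ}

/-- From a link inside `Λ` to a self-avoiding walk between two boundary-type mid-edges. -/
theorem nonempty_saw_of_linked {Λ : Finset HexVertex} {u w v t : HexVertex}
    (hl : Linked (↑Λ : Set HexVertex) w v) (hu : u ∉ Λ) (huw : hexGraph.Adj u w) (ht : t ∉ Λ)
    (hne : s(u, w) ≠ s(v, t)) : Nonempty (HexMidEdgeSAW Λ s(u, w) s(v, t)) := by
  classical
  obtain ⟨hw, hv, ⟨pth⟩⟩ := hl
  set q := pth.toPath with hq
  set l : List HexVertex := q.1.support.map Subtype.val with hl'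
  have hlne : l ≠ [] := by simp [hl', SimpleGraph.Walk.support_ne_nil]
  have hhead : l.head hlne = w := by
    simp only [hl', List.head_map, SimpleGraph.Walk.head_support]
  have hlast : l.getLast hlne = v := by
    simp only [hl', List.getLast_map, SimpleGraph.Walk.getLast_support]
  have hsub : ∀ x ∈ l, x ∈ Λ := by
    intro x hx
    rw [hl', List.mem_map] at hx
    obtain ⟨y, -, rfl⟩ := hx
    exact y.2
  have hnd : l.Nodup := (q.2.support_nodup).map Subtype.val_injective
  have hch : l.IsChain hexGraph.Adj := by
    rw [hl', List.isChain_map]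
    exact q.1.isChain_adj_support.imp fun a b h => SimpleGraph.induce_adj.1 h
  refine ⟨mkSAW Λ u w s(v, t) l hlne hsub hnd hch hhead (by rw [hlast]; exact Sym2.mem_mk_left _ _)
    huw hw (fun h => hu (hsub u h)) ⟨t, Sym2.mem_mk_right _ _, fun h => ht (hsub t h)⟩ hne⟩

theorem linked_cor (hδ : 0 < δ) (hδ1 : δ ≤ 1 / 100) {j : ℕ} (hj : j ≤ Jc δ) :
    Linked (↑(Λfam δ) : Set HexVertex) (cor δ j) (cor δ 0) := by
  induction j with
  | zero => exact Linked.refl (Finset.mem_coe.2 (cor_mem hδ hδ1 hj))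
  | succ j ih =>
    exact (linked_of_adj (Finset.mem_coe.2 (cor_mem hδ hδ1 hj))
      (Finset.mem_coe.2 (cor_mem hδ hδ1 (by omega))) (adj_cor (by omega)).symm).trans (ih (by omega))

theorem linked_Hb (hδ : 0 < δ) (hδ1 : δ ≤ 1 / 100) {v : HexVertex} (hv : v ∈ Hb δ) :
    Linked (↑(Λfam δ) : Set HexVertex) v (h₀ δ) := by
  obtain ⟨hm, hpa, hpb, hbP, hP, hMT, hRA, hclear, hqA, hps, hPa, -⟩ := params2 hδ hδ1
  have hpss : pstar δ = qA δ + iD δ + 1 := rfl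
  have hv' : v = bv (row v) (pos v) := (bv_row_pos v).symm
  set r := row v
  set p := pos v
  rw [hv'] at hv ⊢
  rw [bv_mem_Hb] at hv
  obtain ⟨h1, h2, h3, h4⟩ := hv
  have memS : ∀ r' p' : ℤ, mRow δ ≤ r' → r' ≤ MT δ → -2 ≤ p' → p' ≤ PPos δ →
      bv r' p' ∈ (↑(Λfam δ) : Set HexVertex) := fun r' p' a1 a2 a3 a4 =>
    Finset.mem_coe.2 (Hb_subset_Λfam hδ hδ1 (bv_mem_Hb.2 ⟨a1, a2, a3, a4⟩))
  -- run along the row to the column `pstar`, then climb the band `{pstar, pstar + 1}`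
  have step1 : Linked (↑(Λfam δ) : Set HexVertex) (bv r p) (bv r (pstar δ)) := by
    rcases le_or_gt p (pstar δ) with h | h
    · exact linked_run' r p (pstar δ) h fun t ht1 ht2 => memS _ _ h1 h2 (by omega) (by omega)
    · exact (linked_run' r (pstar δ) p h.le fun t ht1 ht2 => memS _ _ h1 h2 (by omega) (by omega)).symm
  have step2 : Linked (↑(Λfam δ) : Set HexVertex) (bv r (pstar δ)) (bv (MT δ) (pstar δ)) :=
    (linked_band (pstar δ) r (MT δ) h2 fun r' a1 a2 =>
      ⟨memS _ _ (by omega) a2 (by omega) (by omega), memS _ _ (by omega) a2 (by omega) (by omega)⟩).symm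
  exact step1.trans step2

/-- the non-`H` vertices of the family are corridor vertices -/
theorem exists_cor_of_not_mem_Hb (hδ : 0 < δ) (hδ1 : δ ≤ 1 / 100) {v : HexVertex}
    (hv : v ∈ Λfam δ) (hvH : v ∉ Hb δ) : ∃ j, j ≤ Jc δ ∧ v = cor δ j := by
  obtain ⟨hm, hpa, hpb, hbP, hP, hMT, hRA, hclear, hqA, hps, hPa, -, -, -, hiD⟩ := params2 hδ hδ1
  have hJ : Jc δ = 2 * NA δ + 2 * iD δ + 2 := rfl
  have hR : RA δ = mRow δ + NA δ := rfl
  have hv' : v = bv (row v) (pos v) := (bv_row_pos v).symm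
  set r := row v
  set p := pos v
  rw [hv'] at hv hvH ⊢
  rw [bv_mem_Λfam hδ hδ1] at hv
  rw [bv_mem_Hb] at hvH
  rcases hv with hH | ⟨h1, h2, h3⟩ | ⟨h1, h2, h3⟩
  · exact absurd hH hvH
  · obtain ⟨k, hk⟩ : ∃ k : ℕ, (k : ℤ) = r - mRow δ := ⟨(r - mRow δ).toNat, by omega⟩
    rcases h3 with h3 | h3
    · refine ⟨2 * k, by omega, ?_⟩
      rw [cor_even (by omega), bv_eq_bv_iff]; omega
    · refine ⟨2 * k + 1, by omega, ?_⟩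
      rw [cor_odd (by omega), bv_eq_bv_iff]; omega
  · obtain ⟨u, hu⟩ : ∃ u : ℕ, (u : ℤ) = RA δ - r := ⟨(RA δ - r).toNat, by omega⟩
    rcases h3 with ⟨h3, h4⟩ | h3
    · refine ⟨2 * NA δ + 1 + 2 * u, by omega, ?_⟩
      rw [cor_desc_even u, bv_eq_bv_iff]; omega
    · refine ⟨2 * NA δ + 2 + 2 * u, by omega, ?_⟩
      rw [cor_desc_odd u, bv_eq_bv_iff]; omega

theorem linked_Λfam (hδ : 0 < δ) (hδ1 : δ ≤ 1 / 100) {v : HexVertex} (hv : v ∈ Λfam δ) :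
    Linked (↑(Λfam δ) : Set HexVertex) v (cor δ 0) := by
  by_cases hvH : v ∈ Hb δ
  · refine ((linked_Hb hδ hδ1 hvH).trans ?_).trans (linked_cor hδ hδ1 le_rfl)
    exact linked_of_adj (Finset.mem_coe.2 (Hb_subset_Λfam hδ hδ1 (h₀_mem_Hb hδ hδ1)))
      (Finset.mem_coe.2 (cor_mem hδ hδ1 le_rfl)) (adj_cor_h₀ hδ hδ1).symm
  · obtain ⟨j, hj, rfl⟩ := exists_cor_of_not_mem_Hb hδ hδ1 hv hvH
    exact linked_cor hδ hδ1 hj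

theorem preconnected_Λfam (hδ : 0 < δ) (hδ1 : δ ≤ 1 / 100) :
    (hexGraph.induce ((Λfam δ : Finset HexVertex) : Set HexVertex)).Preconnected :=
  preconnected_of_linked fun _ hu _ hv =>
    (linked_Λfam hδ hδ1 hu).trans (linked_Λfam hδ hδ1 hv).symm

theorem nonempty_saw_fam (hδ : 0 < δ) (hδ1 : δ ≤ 1 / 100) :
    Nonempty (HexMidEdgeSAW (Λfam δ) (aE δ) (bE δ)) := by
  obtain ⟨hm, hpa, hpb, -⟩ := params2 hδ hδ1
  rw [aE, bE]
  have hl : Linked (↑(Λfam δ) : Set HexVertex) (bv (mRow δ) (pA δ)) (bv (mRow δ) (pB δ)) := by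
    rw [← cor_zero]
    exact (linked_Λfam hδ hδ1 (Hb_subset_Λfam hδ hδ1 (bv_pB_mem_Hb hδ hδ1))).symm
  refine nonempty_saw_of_linked hl (below_not_mem (by omega)) (adj_aE δ) (below_not_mem (by omega)) ?_
  intro h
  rcases Sym2.eq_iff.1 h with ⟨h1, -⟩ | ⟨h1, -⟩
  · have := (bv_inj h1).1; omega
  · have := (bv_inj h1).2; omega

end Connected


/-! ### The complement of the family is connected (simple connectivity) -/

section Complement

variable {δ : ℝ}

/-- free regions of the complement, in brick coordinates -/
theorem free_left (hδ : 0 < δ) (hδ1 : δ ≤ 1 / 100) {r p : ℤ} (hp : p ≤ pA δ - 1) : ¬ InFam δ r p := by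
  obtain ⟨hm, hpa, hpb, hbP, hP, hMT, hRA, hclear, hqA, hps, hPa, -⟩ := params2 hδ hδ1
  have hq : qA δ = pA δ + NA δ + 1 := rfl
  have hR : RA δ = mRow δ + NA δ := rfl
  unfold InFam; omega

theorem free_right (hδ : 0 < δ) (hδ1 : δ ≤ 1 / 100) {r p : ℤ} (hp : PPos δ + 1 ≤ p) : ¬ InFam δ r p := by
  obtain ⟨hm, hpa, hpb, hbP, hP, hMT, hRA, hclear, hqA, hps, hPa, -, -, -, hiD⟩ := params2 hδ hδ1
  have hq : qA δ = pA δ + NA δ + 1 := rfl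
  have hR : RA δ = mRow δ + NA δ := rfl
  have hpss : pstar δ = qA δ + iD δ + 1 := rfl
  unfold InFam; omega

theorem free_below (hδ : 0 < δ) (hδ1 : δ ≤ 1 / 100) {r p : ℤ} (hr : r ≤ mRow δ - 1) : ¬ InFam δ r p := by
  obtain ⟨hm, hpa, hpb, hbP, hP, hMT, -⟩ := params2 hδ hδ1
  unfold InFam; omega

theorem free_above (hδ : 0 < δ) (hδ1 : δ ≤ 1 / 100) {r p : ℤ} (hr : RA δ + 1 ≤ r) : ¬ InFam δ r p := by
  obtain ⟨hm, hpa, hpb, hbP, hP, hMT, hRA, -⟩ := params2 hδ hδ1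
  unfold InFam; omega

theorem free_leftof (hδ : 0 < δ) (hδ1 : δ ≤ 1 / 100) {r p : ℤ} (_hr1 : mRow δ ≤ r) (hr2 : r ≤ RA δ)
    (hp : p < pA δ + (r - mRow δ)) : ¬ InFam δ r p := by
  obtain ⟨hm, hpa, hpb, hbP, hP, hMT, hRA, hclear, hqA, hps, hPa, -⟩ := params2 hδ hδ1
  have hq : qA δ = pA δ + NA δ + 1 := rfl
  have hR : RA δ = mRow δ + NA δ := rfl
  unfold InFam; omega

theorem free_chan (hδ : 0 < δ) (hδ1 : δ ≤ 1 / 100) {r p : ℤ} (_hr2 : r ≤ MT δ + 1)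
    (hp1 : pA δ + (r - mRow δ) + 2 ≤ p) (hp2 : p ≤ -3) : ¬ InFam δ r p := by
  obtain ⟨hm, hpa, hpb, hbP, hP, hMT, hRA, hclear, hqA, hps, hPa, -, -, -, hiD⟩ := params2 hδ hδ1
  have hq : qA δ = pA δ + NA δ + 1 := rfl
  have hR : RA δ = mRow δ + NA δ := rfl
  unfold InFam; omega

theorem free_arch (hδ : 0 < δ) (hδ1 : δ ≤ 1 / 100) {r p : ℤ} (hr1 : MT δ + 1 ≤ r) (_hr2 : r < RA δ)
    (hp1 : pA δ + (r - mRow δ) + 2 ≤ p) (hp2 : p ≤ qA δ + (RA δ - r) - 1) : ¬ InFam δ r p := by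
  obtain ⟨hm, hpa, hpb, hbP, hP, hMT, hRA, hclear, hqA, hps, hPa, -⟩ := params2 hδ hδ1
  unfold InFam; omega

theorem free_rightof (hδ : 0 < δ) (hδ1 : δ ≤ 1 / 100) {r p : ℤ} (_hr1 : MT δ + 1 ≤ r)
    (hp1 : qA δ + (RA δ - r) + 2 ≤ p) : ¬ InFam δ r p := by
  obtain ⟨hm, hpa, hpb, hbP, hP, hMT, hRA, hclear, hqA, hps, hPa, -⟩ := params2 hδ hδ1
  have hq : qA δ = pA δ + NA δ + 1 := rfl
  have hR : RA δ = mRow δ + NA δ := rfl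
  unfold InFam; omega

set_option maxHeartbeats 800000 in
/-- **Every vertex off the family is linked, off the family, to the anchor `(m-1, pA-3)`.** -/
theorem linked_compl_Λfam (hδ : 0 < δ) (hδ1 : δ ≤ 1 / 100) {v : HexVertex} (hv : v ∉ Λfam δ) :
    Linked ((↑(Λfam δ) : Set HexVertex))ᶜ v (bv (mRow δ - 1) (pA δ - 3)) := by
  obtain ⟨hm, hpa, hpb, hbP, hP, hMT, hRA, hclear, hqA, hps, hPa, -, -, -, hiD⟩ := params2 hδ hδ1
  have hmod := pA_mod δ
  have hq : qA δ = pA δ + NA δ + 1 := rfl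
  have hR : RA δ = mRow δ + NA δ := rfl
  have hpss : pstar δ = qA δ + iD δ + 1 := rfl
  set m := mRow δ with hm'
  set P := PPos δ with hP'
  set XL := pA δ - 3 with hXL
  have hv' : v = bv (row v) (pos v) := (bv_row_pos v).symm
  set r := row v with hr
  set p := pos v with hp
  rw [hv'] at hv ⊢
  rw [bv_mem_Λfam hδ hδ1] at hv
  set C := ((↑(Λfam δ) : Set HexVertex))ᶜ with hC
  have nm : ∀ r' p' : ℤ, ¬ InFam δ r' p' → bv r' p' ∈ C := fun r' p' h => by
    rw [hC, Set.mem_compl_iff, Finset.mem_coe, bv_mem_Λfam hδ hδ1]; exact h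
  -- the left funnel: column `XL` (and `XL + 1`) is free at every row
  have freeL : ∀ r' : ℤ, bv r' XL ∈ C ∧ bv r' (XL + 1) ∈ C := fun r' =>
    ⟨nm _ _ (free_left hδ hδ1 (by omega)), nm _ _ (free_left hδ hδ1 (by omega))⟩
  have bandL : ∀ r' : ℤ, Linked C (bv r' XL) (bv (m - 1) XL) := by
    intro r'
    rcases le_or_gt r' (m - 1) with h | h
    · exact (linked_band XL r' (m - 1) h fun r'' _ _ => freeL r'').symm
    · exact linked_band XL (m - 1) r' h.le fun r'' _ _ => freeL r''
  have routeL : ∀ r' p' : ℤ, (∀ t, min p' XL ≤ t → t ≤ max p' XL → bv r' t ∈ C) →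
      Linked C (bv r' p') (bv (m - 1) XL) := by
    intro r' p' hfree
    have step1 : Linked C (bv r' p') (bv r' XL) := by
      rcases le_or_gt p' XL with h | h
      · exact linked_run' r' p' XL h fun t h1 h2 => hfree t (by omega) (by omega)
      · exact (linked_run' r' XL p' h.le fun t h1 h2 => hfree t (by omega) (by omega)).symm
    exact step1.trans (bandL r')
  -- the right funnel: columns `P + 1`, `P + 2`, then the bottom row `m - 1`
  have routeR : ∀ r' p' : ℤ, m - 1 ≤ r' → (∀ t, p' ≤ t → t ≤ P + 1 → bv r' t ∈ C) →
      Linked C (bv r' p') (bv (m - 1) XL) := by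
    intro r' p' hr' hfree
    have step1 : Linked C (bv r' p') (bv r' (P + 1)) := by
      rcases le_or_gt p' (P + 1) with h | h
      · exact linked_run' r' p' (P + 1) h fun t h1 h2 => hfree t h1 h2
      · exact (linked_run' r' (P + 1) p' h.le fun t h1 h2 =>
          nm _ _ (free_right hδ hδ1 (by omega))).symm
    have step2 : Linked C (bv r' (P + 1)) (bv (m - 1) (P + 1)) :=
      linked_band (P + 1) (m - 1) r' hr' fun r'' _ _ =>
        ⟨nm _ _ (free_right hδ hδ1 (by omega)), nm _ _ (free_right hδ hδ1 (by omega))⟩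
    have step3 : Linked C (bv (m - 1) (P + 1)) (bv (m - 1) XL) :=
      (linked_run' (m - 1) XL (P + 1) (by omega) fun t _ _ => nm _ _ (free_below hδ hδ1 (by omega))).symm
    exact (step1.trans step2).trans step3
  -- the channel between the rising staircase and `H`: band `{-4, -3}` down to row `m - 1`
  have chan : ∀ r' p' : ℤ, m - 1 ≤ r' → r' ≤ MT δ + 1 → pA δ + (r' - m) + 2 ≤ p' → p' ≤ -3 →
      Linked C (bv r' p') (bv (m - 1) XL) := by
    intro r' p' hr1 hr2 hp1 hp2
    have step1 : Linked C (bv r' p') (bv r' (-4)) := by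
      rcases le_or_gt p' (-4) with h | h
      · exact linked_run' r' p' (-4) h fun t h1 h2 => nm _ _ (free_chan hδ hδ1 hr2 (by omega) (by omega))
      · exact (linked_run' r' (-4) p' h.le fun t h1 h2 =>
          nm _ _ (free_chan hδ hδ1 hr2 (by omega) (by omega))).symm
    have step2 : Linked C (bv r' (-4)) (bv (m - 1) (-4)) :=
      linked_band (-4) (m - 1) r' hr1 fun r'' h1 h2 =>
        ⟨nm _ _ (free_chan hδ hδ1 (by omega) (by omega) (by omega)),
         nm _ _ (free_chan hδ hδ1 (by omega) (by omega) (by omega))⟩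
    have step3 : Linked C (bv (m - 1) (-4)) (bv (m - 1) XL) :=
      (linked_run' (m - 1) XL (-4) (by omega) fun t _ _ => nm _ _ (free_below hδ hδ1 (by omega))).symm
    exact (step1.trans step2).trans step3
  -- inside the arch: descend to row `MT + 1`, then take the channel
  have arch : ∀ n : ℕ, ∀ p' : ℤ, (MT δ + 1 + n : ℤ) < RA δ →
      pA δ + ((MT δ + 1 + n : ℤ) - m) + 2 ≤ p' → p' ≤ qA δ + (RA δ - (MT δ + 1 + n : ℤ)) - 1 →
      Linked C (bv (MT δ + 1 + n) p') (bv (m - 1) XL) := by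
    intro n
    induction n with
    | zero =>
      intro p' hr hp1 hp2
      simp only [Nat.cast_zero, add_zero] at hr hp1 hp2 ⊢
      -- run left along row `MT + 1` into the channel
      have step1 : Linked C (bv (MT δ + 1) p') (bv (MT δ + 1) (-3)) := by
        rcases le_or_gt p' (-3) with h | h
        · exact linked_run' _ p' (-3) h fun t h1 h2 =>
            nm _ _ (free_chan hδ hδ1 le_rfl (by omega) (by omega))
        · refine (linked_run' _ (-3) p' h.le fun t h1 h2 => nm _ _ ?_).symm
          rcases le_or_gt t (-3) with h3 | h3
          · exact free_chan hδ hδ1 le_rfl (by omega) h3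
          · exact free_arch hδ hδ1 le_rfl hr (by omega) (by omega)
      exact step1.trans (chan (MT δ + 1) (-3) (by omega) le_rfl (by omega) le_rfl)
    | succ n ih =>
      intro p' hr hp1 hp2
      have hrow : (MT δ + 1 + (n + 1 : ℕ) : ℤ) = MT δ + 1 + n + 1 := by push_cast; ring
      rw [hrow] at hr hp1 hp2 ⊢
      set r' : ℤ := MT δ + 1 + n with hr'
      have memv : bv (r' + 1) p' ∈ C := nm _ _ (free_arch hδ hδ1 (by omega) hr hp1 hp2)
      by_cases hpar : (p' - (r' + 1)) % 2 = 0
      · -- straight down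
        have hdown : bv r' p' ∈ C := nm _ _ (free_arch hδ hδ1 (by omega) (by omega) (by omega) (by omega))
        refine (linked_of_adj memv hdown ?_).trans (ih p' (by omega) (by omega) (by omega))
        rw [adj_bv_iff]; right; left; exact ⟨rfl, by ring, hpar⟩
      · -- one step sideways inside the arch (to the left if possible, else to the right), then down
        by_cases hleft : pA δ + (r' + 1 - m) + 3 ≤ p'
        · have hside : bv (r' + 1) (p' - 1) ∈ C :=
            nm _ _ (free_arch hδ hδ1 (by omega) hr (by omega) (by omega))
          have hdown : bv r' (p' - 1) ∈ C :=
            nm _ _ (free_arch hδ hδ1 (by omega) (by omega) (by omega) (by omega))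
          refine ((linked_of_adj memv hside ?_).trans (linked_of_adj hside hdown ?_)).trans
            (ih (p' - 1) (by omega) (by omega) (by omega))
          · rw [adj_bv_iff]; left; exact ⟨rfl, Or.inr rfl⟩
          · rw [adj_bv_iff]; right; left; exact ⟨rfl, by ring, by omega⟩
        · have hp' : p' = pA δ + (r' + 1 - m) + 2 := by omega
          have hwide : p' + 1 ≤ qA δ + (RA δ - (r' + 1)) - 1 := by omega
          have hside : bv (r' + 1) (p' + 1) ∈ C :=
            nm _ _ (free_arch hδ hδ1 (by omega) hr (by omega) hwide)
          have hdown : bv r' (p' + 1) ∈ C :=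
            nm _ _ (free_arch hδ hδ1 (by omega) (by omega) (by omega) (by omega))
          refine ((linked_of_adj memv hside ?_).trans (linked_of_adj hside hdown ?_)).trans
            (ih (p' + 1) (by omega) (by omega) (by omega))
          · rw [adj_bv_iff]; left; exact ⟨rfl, Or.inl rfl⟩
          · rw [adj_bv_iff]; right; left; exact ⟨rfl, by ring, by omega⟩
  -- case analysis on the position of `v`
  unfold InFam at hv
  by_cases hA : r ≤ m - 1 ∨ RA δ + 1 ≤ r
  · refine routeL r p fun t _ _ => nm _ _ ?_
    rcases hA with h | h
    · exact free_below hδ hδ1 h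
    · exact free_above hδ hδ1 h
  have hA1 : m ≤ r := by omega
  have hA2 : r ≤ RA δ := by omega
  by_cases hB : p < pA δ + (r - m)
  · exact routeL r p fun t h1 h2 => nm _ _ (free_leftof hδ hδ1 (by omega) (by omega) (by omega))
  have hB2 : pA δ + (r - m) + 2 ≤ p := by omega
  by_cases hCrow : r ≤ MT δ
  · -- rows of `H`: either right of `H` or in the channel
    by_cases hright : P < p
    · exact routeR r p (by omega) fun t h1 h2 => nm _ _ (free_right hδ hδ1 (by omega))
    · have hp3 : p ≤ -3 := by omega
      exact chan r p (by omega) (by omega) hB2 hp3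
  · -- above `H`
    by_cases hright : qA δ + (RA δ - r) + 2 ≤ p
    · exact routeR r p (by omega) fun t h1 h2 => nm _ _ (by
        rcases le_or_gt t P with h3 | h3
        · exact free_rightof hδ hδ1 (by omega) (by omega)
        · exact free_right hδ hδ1 (by omega))
    · -- inside the arch
      have hrRA : r < RA δ := by omega
      have harch : p ≤ qA δ + (RA δ - r) - 1 := by omega
      obtain ⟨n, hn⟩ : ∃ n : ℕ, r = MT δ + 1 + n := ⟨(r - MT δ - 1).toNat, by omega⟩
      rw [hn] at hrRA hB2 harch ⊢
      exact arch n p hrRA hB2 harch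

theorem simplyConnected_Λfam (hδ : 0 < δ) (hδ1 : δ ≤ 1 / 100) : hexDomainSimplyConnected (Λfam δ) :=
  preconnected_of_linked fun _ hu _ hv =>
    (linked_compl_Λfam hδ hδ1 (fun h => hu h)).trans (linked_compl_Λfam hδ hδ1 (fun h => hv h)).symm

end Complement


/-! ## §N6. The starved normaliser `Z(b_δ) ≤ x_c^{J+1}`, the `K`-edge mass `x_c^{2 iK2 + 1}`, and the
two refutations -/

section Violation

variable {δ : ℝ}

/-! ### The chart rooted at the exit dart `cor J → h₀` and the strip comparison for `H` -/

/-- the chart of the honeycomb lattice sending the exit dart `cor J → h₀` to the standard entrance -/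
noncomputable def Φfam (δ : ℝ) : hexGraph ≃g hvGraph := hvIso.trans (HV.toOrigin (toHV (h₀ δ)))

theorem toHV_bv_even {r p : ℤ} (h : (p - r) % 2 = 0) : toHV (bv r p) = ((p - r) / 2, r, false) := by
  simp [toHV, bv, h]

theorem toHV_bv_odd {r p : ℤ} (h : (p - r) % 2 = 1) : toHV (bv r p) = ((p - r - 1) / 2, r, true) := by
  simp [toHV, bv, h]

theorem pstar_sub_MT_mod (hδ : 0 < δ) (hδ1 : δ ≤ 1 / 100) : (pstar δ - MT δ) % 2 = 1 := by
  have hmod := pA_mod δ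
  obtain ⟨-, -, -, -, -, -, -, -, -, -, -, -, -, -, hiD⟩ := params2 hδ hδ1
  have hps : pstar δ = pA δ + NA δ + 1 + iD δ + 1 := rfl
  have hR : RA δ = mRow δ + NA δ := rfl
  omega

theorem Φfam_bv_even (hδ : 0 < δ) (hδ1 : δ ≤ 1 / 100) {r p : ℤ} (h : (p - r) % 2 = 0) :
    Φfam δ (bv r p) = ((pstar δ - MT δ - 1) / 2 - (p - r) / 2, MT δ - r, true) := by
  have hodd := pstar_sub_MT_mod hδ hδ1
  show HV.toOrigin (toHV (h₀ δ)) (toHV (bv r p)) = _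
  rw [h₀, toHV_bv_odd hodd, toHV_bv_even h]
  simp [HV.toOrigin]
  constructor <;> ring

theorem Φfam_bv_odd (hδ : 0 < δ) (hδ1 : δ ≤ 1 / 100) {r p : ℤ} (h : (p - r) % 2 = 1) :
    Φfam δ (bv r p) = ((pstar δ - MT δ - 1) / 2 - (p - r - 1) / 2, MT δ - r, false) := by
  have hodd := pstar_sub_MT_mod hδ hδ1
  show HV.toOrigin (toHV (h₀ δ)) (toHV (bv r p)) = _
  rw [h₀, toHV_bv_odd hodd, toHV_bv_odd h]
  simp [HV.toOrigin]
  constructor <;> ring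

/-! ### The starved normaliser: `|F_σ(b_δ)| ≤ Z(b_δ) ≤ x_c^{J+1}` -/

/-- height and width of the comparison strip -/
noncomputable def Tfam (δ : ℝ) : ℕ := (MT δ - mRow δ + 1).toNat
noncomputable def Lfam (δ : ℝ) : ℕ := (10 * PPos δ).toNat

theorem Hb_in_strip (hδ : 0 < δ) (hδ1 : δ ≤ 1 / 100) :
    ∀ f ∈ Hb δ, Φfam δ f ∈ HV.stripV (Tfam δ) (Lfam δ) := by
  obtain ⟨hm, hpa, hpb, hbP, hP, hMT, hRA, hclear, hqA, hps, hPa, -⟩ := params2 hδ hδ1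
  obtain ⟨hRP, hPm, -, hpsP, hmM⟩ := params3 hδ hδ1
  have hT : (Tfam δ : ℤ) = MT δ - mRow δ + 1 := by rw [Tfam, Int.toNat_of_nonneg (by omega)]
  have hL : (Lfam δ : ℤ) = 10 * PPos δ := by rw [Lfam, Int.toNat_of_nonneg (by omega)]
  have hpss : pstar δ = qA δ + iD δ + 1 := rfl
  intro f hf
  rw [← bv_row_pos f, bv_mem_Hb] at hf
  obtain ⟨h1, h2, h3, h4⟩ := hf
  rw [← bv_row_pos f]
  rcases Int.emod_two_eq_zero_or_one (pos f - row f) with h | h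
  · rw [Φfam_bv_even hδ hδ1 h, HV.mem_stripV_iff]
    simp only [HV.lev_mk, HV.bit_true]
    omega
  · rw [Φfam_bv_odd hδ hδ1 h, HV.mem_stripV_iff]
    simp only [HV.lev_mk, HV.bit_false]
    omega

theorem one_le_Tfam (hδ : 0 < δ) (hδ1 : δ ≤ 1 / 100) : 1 ≤ Tfam δ := by
  obtain ⟨-, -, -, -, hmM⟩ := params3 hδ hδ1
  have hT : (Tfam δ : ℤ) = MT δ - mRow δ + 1 := by rw [Tfam, Int.toNat_of_nonneg (by omega)]
  omega

/-- the walks of the block `H` from the exit mid-edge of the corridor to `b_δ` have mass `≤ 1` -/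
theorem sum_Hb_le_one (hδ : 0 < δ) (hδ1 : δ ≤ 1 / 100) :
    ∑ γ : HexMidEdgeSAW (Hb δ) s(cor δ (Jc δ), h₀ δ) s(bv (mRow δ) (pB δ), bv (mRow δ - 1) (pB δ)),
      hexCriticalFugacity ^ γ.length ≤ 1 := by
  obtain ⟨hm, hpa, hpb, hbP, hP, hMT, hRA, hclear, hqA, hps, hPa, -⟩ := params2 hδ hδ1
  obtain ⟨hRP, hPm, -, hpsP, hmM⟩ := params3 hδ hδ1
  have hmodB := pB_mod δ
  have hodd := pstar_sub_MT_mod hδ hδ1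
  have hT : (Tfam δ : ℤ) = MT δ - mRow δ + 1 := by rw [Tfam, Int.toNat_of_nonneg (by omega)]
  refine sum_pow_length_le_one (T := Tfam δ) (L' := Lfam δ) (Φfam δ) (cor_not_mem_Hb hδ hδ1 le_rfl)
    ?_ ?_ (one_le_Tfam hδ hδ1) (Hb_in_strip hδ hδ1) ?_ (adj_bE δ).symm ?_ ?_
  · rw [cor_J' hδ hδ1, Φfam_bv_even hδ hδ1 (by omega)]
    show _ = ((0 : ℤ), (-1 : ℤ), true)
    refine Prod.ext ?_ (Prod.ext ?_ rfl)
    · simp only; omega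
    · simp only; omega
  · rw [h₀, Φfam_bv_odd hδ hδ1 hodd]
    show _ = ((0 : ℤ), (0 : ℤ), false)
    refine Prod.ext ?_ (Prod.ext ?_ rfl)
    · simp only; omega
    · simp only; omega
  · rw [bv_mem_Hb]; omega
  · show (Φfam δ (bv (mRow δ) (pB δ))).2.1 = (Tfam δ : ℤ) - 1 ∧
      (Φfam δ (bv (mRow δ) (pB δ))).2.2 = true ∧
      Φfam δ (bv (mRow δ - 1) (pB δ)) =
        ((Φfam δ (bv (mRow δ) (pB δ))).1, (Φfam δ (bv (mRow δ) (pB δ))).2.1 + 1, false)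
    rw [Φfam_bv_even hδ hδ1 hmodB, Φfam_bv_odd hδ hδ1 (by omega)]
    refine ⟨?_, rfl, Prod.ext ?_ (Prod.ext ?_ rfl)⟩
    · simp only; omega
    · simp only; omega
    · simp only; omega
  · intro h
    rw [cor_J' hδ hδ1] at h
    rcases Sym2.eq_iff.1 h with ⟨h1, -⟩ | ⟨h1, -⟩
    · have := (bv_inj h1).1; omega
    · have := (bv_inj h1).1; omega

/-- **the normaliser is starved**: `|F_σ(b_δ)| ≤ x_c^{J+1}` for every spin `σ` -/
theorem norm_obs_bE_le (hδ : 0 < δ) (hδ1 : δ ≤ 1 / 100) (σ : ℝ) :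
    ‖hexParafermionicObservable (Λfam δ) (aE δ) hexCriticalFugacity σ (bE δ)‖ ≤
      hexCriticalFugacity ^ (Jc δ + 1) := by
  obtain ⟨hm, hpa, hpb, -⟩ := params2 hδ hδ1
  have hx0 := hexCriticalFugacity_pos_lt_one.1.le
  rw [aE_eq_cor, bE]
  refine (norm_hexParafermionicObservable_le _ _ hx0 _ _).trans ?_
  have key := sum_pow_length_le_corridor (Λ := Λfam δ) (Λ' := Hb δ) (u := bv (mRow δ - 1) (pA δ))
    (c := cor δ) (L := Jc δ) (h := h₀ δ) (z := s(bv (mRow δ) (pB δ), bv (mRow δ - 1) (pB δ)))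
    (below_not_mem (by omega)) (cor_bare hδ hδ1) ?_ ?_ (adj_cor_h₀ hδ hδ1) hx0
  · refine key.trans ?_
    have := mul_le_mul_of_nonneg_left (sum_Hb_le_one hδ hδ1) (pow_nonneg hx0 (Jc δ + 1))
    rwa [mul_one] at this
  · intro i hi hmem
    rcases Sym2.mem_iff.1 hmem with h' | h'
    · exact cor_not_mem_Hb hδ hδ1 hi (h' ▸ bv_pB_mem_Hb hδ hδ1)
    · have := (cor_spec hδ hδ1 hi).2.2
      rw [h', row_bv] at this; omega
  · intro v hv hne
    by_contra hvH
    obtain ⟨j, hj, rfl⟩ := exists_cor_of_not_mem_Hb hδ hδ1 hv hvH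
    exact hne j hj rfl

/-! ### The `K`-edge on the corridor -/

/-- the outer (non-family) neighbour of the rising vertex `cor (2 iK2) = (m + iK2, pA + iK2)` -/
noncomputable def ystar (δ : ℝ) : HexVertex := bv (mRow δ + iK2 δ) (pA δ + iK2 δ - 1)
/-- the `K`-edge: the side mid-edge of the corridor at height `≈ 0` -/
noncomputable def estar (δ : ℝ) : Sym2 HexVertex := s(cor δ (2 * iK2 δ), ystar δ)
/-- the test compact `[-3/5, -1/4] × [-3/20, 3/20] ⊂ D₀` -/
def Kfam : Set ℂ := Set.Icc (-3 / 5 : ℝ) (-1 / 4) ×ℂ Set.Icc (-3 / 20 : ℝ) (3 / 20)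

theorem Kfam_compact : IsCompact Kfam := isCompact_Icc.reProdIm isCompact_Icc

theorem Kfam_sub : Kfam ⊆ D₀.carrier := by
  intro z hz
  rw [Kfam, Complex.mem_reProdIm, Set.mem_Icc, Set.mem_Icc] at hz
  rw [mem_D₀_carrier]
  refine ⟨⟨by linarith [hz.1.1], by linarith [hz.1.2]⟩, by linarith [hz.2.1], by linarith [hz.2.2]⟩

theorem mem_Kfam {z : ℂ} : z ∈ Kfam ↔ (-3 / 5 ≤ z.re ∧ z.re ≤ -1 / 4) ∧ (-3 / 20 ≤ z.im ∧ z.im ≤ 3 / 20) := by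
  rw [Kfam, Complex.mem_reProdIm, Set.mem_Icc, Set.mem_Icc]

theorem cor_two_iK2 (hδ : 0 < δ) (hδ1 : δ ≤ 1 / 100) :
    cor δ (2 * iK2 δ) = bv (mRow δ + iK2 δ) (pA δ + iK2 δ) := by
  obtain ⟨-, -, -, -, -, -, -, -, -, -, -, hK, -⟩ := params2 hδ hδ1
  exact cor_even (by push_cast at hK; omega)

theorem ystar_not_mem (hδ : 0 < δ) (hδ1 : δ ≤ 1 / 100) : ystar δ ∉ Λfam δ := by
  obtain ⟨hm, hpa, hpb, hbP, hP, hMT, hRA, hclear, hqA, hps, hPa, hK, -⟩ := params2 hδ hδ1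
  have hq : qA δ = pA δ + NA δ + 1 := rfl
  have hR : RA δ = mRow δ + NA δ := rfl
  rw [ystar, bv_mem_Λfam hδ hδ1]
  unfold InFam
  push_cast at hK
  omega

theorem adj_cor_ystar (hδ : 0 < δ) (hδ1 : δ ≤ 1 / 100) : hexGraph.Adj (cor δ (2 * iK2 δ)) (ystar δ) := by
  rw [cor_two_iK2 hδ hδ1, ystar, adj_bv_iff]
  left; exact ⟨rfl, Or.inr rfl⟩

theorem estar_mem (hδ : 0 < δ) (hδ1 : δ ≤ 1 / 100) : estar δ ∈ hexDomainMidEdges (Λfam δ) := by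
  obtain ⟨-, -, -, -, -, -, -, -, -, -, -, hK, -⟩ := params2 hδ hδ1
  have hJ : Jc δ = 2 * NA δ + 2 * iD δ + 2 := rfl
  exact ⟨(SimpleGraph.mem_edgeSet _).2 (adj_cor_ystar hδ hδ1), cor δ (2 * iK2 δ),
    Sym2.mem_mk_left _ _, cor_mem hδ hδ1 (by push_cast at hK; omega)⟩

/-- **the `K`-edge carries the mass of exactly one walk**: `|F_σ(e⋆)| = x_c^{2 iK2 + 1}` -/
theorem norm_obs_estar (hδ : 0 < δ) (hδ1 : δ ≤ 1 / 100) (σ : ℝ) :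
    ‖hexParafermionicObservable (Λfam δ) (aE δ) hexCriticalFugacity σ (estar δ)‖ =
      hexCriticalFugacity ^ (2 * iK2 δ + 1) := by
  obtain ⟨hm, hpa, hpb, hbP, hP, hMT, hRA, hclear, hqA, hps, hPa, hK, -⟩ := params2 hδ hδ1
  obtain ⟨-, -, hiK1, -⟩ := params3 hδ hδ1
  have hJ : Jc δ = 2 * NA δ + 2 * iD δ + 2 := rfl
  push_cast at hK
  have hx0 := hexCriticalFugacity_pos_lt_one.1.le
  obtain ⟨L, hL⟩ : ∃ L : ℕ, 2 * iK2 δ = L + 1 := ⟨2 * iK2 δ - 1, by omega⟩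
  have hLJ : L + 1 < Jc δ := by omega
  rw [aE_eq_cor, estar, hL, show L + 1 + 1 = L + 2 by ring]
  have hy := ystar_not_mem hδ hδ1
  refine norm_obs_corridor_exit_side (c := cor δ) (L := L) (h := cor δ (L + 1))
    (below_not_mem (by omega)) ?_ hy ?_ (fun i hi => cor_mem hδ hδ1 (by omega))
    (cor_mem hδ hδ1 (by omega)) (fun i j hi hj hij => cor_inj hδ hδ1 (by omega) (by omega) hij)
    (fun i hi hci => by have := cor_inj hδ hδ1 (by omega) (by omega) hci; omega)
    (fun i hi => adj_cor (by omega)) (by rw [cor_zero]; exact adj_aE δ) (adj_cor (by omega)) hx0 σ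
  · intro i hi v hv hadj
    rcases cor_bare hδ hδ1 i (by omega) v hv hadj with h1 | ⟨-, h2⟩ | ⟨h3, -⟩
    · exact Or.inl h1
    · rcases Nat.lt_or_ge i L with hiL | hiL
      · exact Or.inr (Or.inl ⟨hiL, h2⟩)
      · have : i = L := by omega
        subst this
        exact Or.inr (Or.inr ⟨rfl, h2⟩)
    · omega
  · intro i hi hmem
    rcases Sym2.mem_iff.1 hmem with h' | h'
    · have := cor_inj hδ hδ1 (by omega) (by omega) h'; omega
    · exact hy (h' ▸ cor_mem hδ hδ1 (by omega))

theorem scaled_estar (hδ : 0 < δ) (hδ1 : δ ≤ 1 / 100) : (δ : ℂ) * hexMidpoint (estar δ) =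
    ⟨δ * (2 * (pA δ : ℝ) + 2 * (iK2 δ : ℝ) + 1) / 4,
      δ * hgt * ((mRow δ : ℝ) + (iK2 δ : ℝ) + 1 / 2)⟩ := by
  have hmod := pA_mod δ
  have heven : (pA δ + iK2 δ - (mRow δ + iK2 δ)) % 2 = 0 := by omega
  have hodd : (pA δ + iK2 δ - 1 - (mRow δ + iK2 δ)) % 2 = 1 := by omega
  rw [estar, cor_two_iK2 hδ hδ1, ystar]
  apply Complex.ext
  · rw [Complex.re_ofReal_mul, mid_re, pos_bv, pos_bv]; simp; ring
  · rw [Complex.im_ofReal_mul, mid_im, im_center_bv_even heven, im_center_bv_odd hodd]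
    simp; ring

theorem estar_mem_Kfam (hδ : 0 < δ) (hδ1 : δ ≤ 1 / 100) : (δ : ℂ) * hexMidpoint (estar δ) ∈ Kfam := by
  rw [scaled_estar hδ hδ1, mem_Kfam]
  simp only
  obtain ⟨h1, h2⟩ := pA_re hδ
  have h3 := mRow_height hδ
  have h4 := mRow_height' hδ
  have h5 := iK2_le hδ
  have h6 := lt_iK2 δ
  have htm := t_mul hδ
  have hg := hgt_pos
  have hg' := hgt_lt
  have hg'' := hgt_gt
  have hp : 0 < δ * hgt := by positivity
  -- `δ hgt iK2 ∈ (1 - δ hgt, 1]`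
  have k1 : δ * hgt * (iK2 δ : ℝ) ≤ 1 := by
    have := mul_le_mul_of_nonneg_left h5 hp.le
    rwa [htm] at this
  have k2 : 1 - δ * hgt < δ * hgt * (iK2 δ : ℝ) := by
    have := mul_lt_mul_of_pos_left h6 hp
    rw [mul_sub, htm, mul_one] at this
    exact this
  -- hence `δ iK2 ∈ (8/7 - δ, 20/17)`
  have hk0 : 0 ≤ δ * (iK2 δ : ℝ) := by positivity
  have k3 : δ * (iK2 δ : ℝ) < 20 / 17 := by nlinarith
  have k4 : 8 / 7 - δ < δ * (iK2 δ : ℝ) := by nlinarith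
  have e1 : δ * hgt ≤ 1 / 100 := by nlinarith
  refine ⟨⟨by nlinarith, by nlinarith⟩, by nlinarith, by nlinarith⟩

end Violation



/-! ### The frame of the crux (without exhaustion) holds for the family, and the comparison fails -/

section Final

variable {δ : ℝ}

theorem frame_fam : ∀ᶠ δ : ℝ in nhdsWithin 0 (Set.Ioi 0),
    hexDomainSimplyConnected (Λfam δ) ∧ aE δ ∈ hexDomainBoundary (Λfam δ) ∧
      bE δ ∈ hexDomainBoundary (Λfam δ) ∧ Nonempty (HexMidEdgeSAW (Λfam δ) (aE δ) (bE δ)) ∧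
      (hexGraph.induce ((Λfam δ : Finset HexVertex) : Set HexVertex)).Preconnected ∧
      (∀ v ∈ Λfam δ, (δ : ℂ) * hexCenter v ∈ D₀.carrier) ∧
      (∀ v : HexVertex, (δ : ℂ) * hexCenter v ∈ Metric.ball (D₀.pt 1) 1 →
        (v ∈ Λfam δ ↔ mRow δ ≤ v.1 1)) := by
  filter_upwards [Ioo_mem_nhdsGT (show (0:ℝ) < 1 / 100 by norm_num)] with δ hδ
  have hδ0 := hδ.1
  have hδ1 : δ ≤ 1 / 100 := hδ.2.le
  exact ⟨simplyConnected_Λfam hδ0 hδ1, aE_mem_boundary_fam hδ0 hδ1, bE_mem_boundary_fam hδ0 hδ1,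
    nonempty_saw_fam hδ0 hδ1, preconnected_Λfam hδ0 hδ1, inside_Λfam hδ0 hδ1, rows_Λfam hδ0 hδ1⟩

/-- **THE CORE COMPARISON (corridor-through-`K` family), any spin.** For the compact `Kfam`, no
constant `C` bounds the `K`-averaged bulk mass of `F_σ` by `C δ^{-3/4} |F_σ(b_δ)|`. -/
theorem fam_violates (C : ℝ) (σ : ℝ) :
    ¬ (∀ᶠ δ : ℝ in nhdsWithin 0 (Set.Ioi 0),
      δ ^ 2 * (∑ᶠ e ∈ {e : Sym2 HexVertex | e ∈ hexDomainMidEdges (Λfam δ) ∧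
        (δ : ℂ) * hexMidpoint e ∈ Kfam},
        ‖hexParafermionicObservable (Λfam δ) (aE δ) hexCriticalFugacity σ e‖) ≤
      C * δ ^ (-(3 : ℝ) / 4) *
        ‖hexParafermionicObservable (Λfam δ) (aE δ) hexCriticalFugacity σ (bE δ)‖) := by
  intro hev
  have hx0 := hexCriticalFugacity_pos_lt_one.1
  refine endgame hx0 xc_lt.le C (fun δ => 2 * iK2 δ + 1) (fun δ => Jc δ + 1 - (2 * iK2 δ + 1))
    (fun δ => iK δ / 2) ?_ ?_
  · filter_upwards [hev, Ioo_mem_nhdsGT (show (0:ℝ) < 1 / 100 by norm_num)] with δ hδ hδ'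
    have hδ0 := hδ'.1
    have hδ1 : δ ≤ 1 / 100 := hδ'.2.le
    obtain ⟨-, -, -, -, -, -, -, -, -, -, -, hK, hN, -⟩ := params2 hδ0 hδ1
    -- the left-hand side dominates `δ² x^{2 iK2 + 1}`
    have hE : ({e : Sym2 HexVertex | e ∈ hexDomainMidEdges (Λfam δ) ∧
        (δ : ℂ) * hexMidpoint e ∈ Kfam}).Finite :=
      (hexDomainMidEdges_finite (Λfam δ)).subset fun e he => he.1
    have hterm := term_le_finsum_mem hE (f := fun e =>
      ‖hexParafermionicObservable (Λfam δ) (aE δ) hexCriticalFugacity σ e‖) (fun e => norm_nonneg _)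
      ⟨estar_mem hδ0 hδ1, estar_mem_Kfam hδ0 hδ1⟩
    have hstar := norm_obs_estar hδ0 hδ1 σ
    rw [hstar] at hterm
    have hlhs : δ ^ 2 * hexCriticalFugacity ^ (2 * iK2 δ + 1) ≤
        δ ^ 2 * (∑ᶠ e ∈ {e : Sym2 HexVertex | e ∈ hexDomainMidEdges (Λfam δ) ∧
          (δ : ℂ) * hexMidpoint e ∈ Kfam},
          ‖hexParafermionicObservable (Λfam δ) (aE δ) hexCriticalFugacity σ e‖) :=
      mul_le_mul_of_nonneg_left hterm (by positivity)
    -- the right-hand side is at most `C δ^{-3/4} x^{J + 1}` once `C > 0`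
    have hbE := norm_obs_bE_le hδ0 hδ1 σ
    have hexp : Jc δ + 1 = 2 * iK2 δ + 1 + (Jc δ + 1 - (2 * iK2 δ + 1)) := by
      push_cast at hK hN; omega
    have hpos : 0 < δ ^ 2 * hexCriticalFugacity ^ (2 * iK2 δ + 1) := by positivity
    have hrpow : 0 < δ ^ (-(3:ℝ) / 4) := Real.rpow_pos_of_pos hδ0 _
    rcases le_or_gt C 0 with hC | hC
    · exfalso
      have : C * δ ^ (-(3:ℝ) / 4) *
          ‖hexParafermionicObservable (Λfam δ) (aE δ) hexCriticalFugacity σ (bE δ)‖ ≤ 0 :=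
        mul_nonpos_of_nonpos_of_nonneg (mul_nonpos_of_nonpos_of_nonneg hC hrpow.le) (norm_nonneg _)
      linarith [hlhs.trans hδ]
    · rw [← hexp]
      refine hlhs.trans (hδ.trans ?_)
      exact mul_le_mul_of_nonneg_left hbE (mul_pos hC hrpow).le
  · filter_upwards [Ioo_mem_nhdsGT (show (0:ℝ) < 1 / 100 by norm_num)] with δ hδ'
    have hδ0 := hδ'.1
    have hδ1 : δ ≤ 1 / 100 := hδ'.2.le
    obtain ⟨-, -, -, -, -, -, -, -, -, -, -, hK, hN, hn, -⟩ := params2 hδ0 hδ1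
    refine ⟨?_, hn⟩
    push_cast at hK hN
    omega

/-! ### `MassRatio` without the exhaustion clause is FALSE -/

/-- `MassRatio` (stmt-CriticalPhenomena-8550) with the EXHAUSTION conjunct
`∀ K compact ⊆ Ω, ∀ᶠ δ, ∀ v, δ·c_v ∈ K → v ∈ Λ_δ` DELETED, everything else verbatim. -/
def MassRatioWithoutExhaustion : Prop :=
  ∀ (D : Literature.Probability.RandomPlanarGeometry.DobrushinDomain) (ρ : ℝ)
    (Λ : ℝ → Finset HexVertex) (m : ℝ → ℤ) (a b : ℝ → Sym2 HexVertex),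
  let Z : ℝ → Sym2 HexVertex → ℂ := fun δ z =>
    hexParafermionicObservable (Λ δ) (a δ) hexCriticalFugacity 0 z;
  0 < ρ → D.carrier ∩ Metric.ball (D.pt 1) ρ = {z : ℂ | (D.pt 1).im < z.im} ∩ Metric.ball (D.pt 1) ρ →
  (∀ᶠ δ : ℝ in nhdsWithin 0 (Set.Ioi 0), hexDomainSimplyConnected (Λ δ) ∧
    a δ ∈ hexDomainBoundary (Λ δ) ∧ b δ ∈ hexDomainBoundary (Λ δ) ∧
    Nonempty (HexMidEdgeSAW (Λ δ) (a δ) (b δ)) ∧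
    (hexGraph.induce ((Λ δ : Finset HexVertex) : Set HexVertex)).Preconnected ∧
    (∀ v ∈ Λ δ, (δ : ℂ) * hexCenter v ∈ D.carrier) ∧
    (∀ v : HexVertex, (δ : ℂ) * hexCenter v ∈ Metric.ball (D.pt 1) ρ → (v ∈ Λ δ ↔ m δ ≤ v.1 1))) →
  Filter.Tendsto (fun δ : ℝ => (δ : ℂ) * hexMidpoint (a δ)) (nhdsWithin 0 (Set.Ioi 0)) (nhds (D.pt 0)) →
  Filter.Tendsto (fun δ : ℝ => (δ : ℂ) * hexMidpoint (b δ)) (nhdsWithin 0 (Set.Ioi 0)) (nhds (D.pt 1)) →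
  ∀ K : Set ℂ, IsCompact K → K ⊆ D.carrier → ∃ C : ℝ, ∀ᶠ δ : ℝ in nhdsWithin 0 (Set.Ioi 0),
    δ ^ 2 * (∑ᶠ e ∈ {e : Sym2 HexVertex | e ∈ hexDomainMidEdges (Λ δ) ∧
      (δ : ℂ) * hexMidpoint e ∈ K}, ‖Z δ e‖) ≤ C * δ ^ (-(3 : ℝ) / 4) * ‖Z δ (b δ)‖

/-- **LOAD-BEARING: the exhaustion clause.** `MassRatio` with the exhaustion conjunct deleted is
FALSE: a bare corridor from the root through the compact `K` into the block at `b` makes the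
`K`-edge mass `x_c^{2 iK2 + 1}` while the normaliser pays the whole corridor, `Z(b_δ) ≤ x_c^{J+1}`
(Duminil-Copin–Smirnov Lemma 2 in a comparison strip), `J + 1 - (2 iK2 + 1) ≳ 3/δ`. -/
theorem massRatio_false_without_exhaustion : ¬ MassRatioWithoutExhaustion := by
  intro h
  obtain ⟨C, hC⟩ := h D₀ 1 Λfam mRow aE bE one_pos D₀_flat frame_fam tendsto_aE tendsto_bE
    Kfam Kfam_compact Kfam_sub
  exact fam_violates C 0 hC

/-! ### `stub_localL1Bound` (line `coherence-floor-rh-harnack`) without exhaustion is FALSE -/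

/-- `LocalL1Bound s` of the line skeleton `Cruxes/MassRatio/Lines/coherence-floor-rh-harnack.lean`
(the registered stub `stub_localL1Bound` is `∀ s > 0, LocalL1Bound s`) with the EXHAUSTION
conjunct DELETED from its frame, everything else verbatim. -/
def LocalL1BoundWithoutExhaustion (s : ℝ) : Prop :=
  ∀ (D : DobrushinDomain) (ρ : ℝ) (Λ : ℝ → Finset HexVertex) (m : ℝ → ℤ)
    (a b : ℝ → Sym2 HexVertex),
    0 < ρ →
    D.carrier ∩ Metric.ball (D.pt 1) ρ = {z : ℂ | (D.pt 1).im < z.im} ∩ Metric.ball (D.pt 1) ρ →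
    (∀ᶠ δ : ℝ in nhdsWithin 0 (Set.Ioi 0),
      hexDomainSimplyConnected (Λ δ) ∧ a δ ∈ hexDomainBoundary (Λ δ) ∧
        b δ ∈ hexDomainBoundary (Λ δ) ∧ Nonempty (HexMidEdgeSAW (Λ δ) (a δ) (b δ)) ∧
        (hexGraph.induce ((Λ δ : Finset HexVertex) : Set HexVertex)).Preconnected ∧
        (∀ v ∈ Λ δ, (δ : ℂ) * hexCenter v ∈ D.carrier) ∧
        (∀ v : HexVertex, (δ : ℂ) * hexCenter v ∈ Metric.ball (D.pt 1) ρ →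
          (v ∈ Λ δ ↔ m δ ≤ v.1 1))) →
    Filter.Tendsto (fun δ : ℝ => (δ : ℂ) * hexMidpoint (a δ)) (nhdsWithin 0 (Set.Ioi 0))
      (nhds (D.pt 0)) →
    Filter.Tendsto (fun δ : ℝ => (δ : ℂ) * hexMidpoint (b δ)) (nhdsWithin 0 (Set.Ioi 0))
      (nhds (D.pt 1)) →
    ∀ K : Set ℂ, IsCompact K → K ⊆ D.carrier → ∃ C : ℝ,
      ∀ᶠ δ : ℝ in nhdsWithin 0 (Set.Ioi 0),
        δ ^ 2 * (∑ᶠ e ∈ {e : Sym2 HexVertex | e ∈ hexDomainMidEdges (Λ δ) ∧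
            (δ : ℂ) * hexMidpoint e ∈ K},
            ‖hexParafermionicObservable (Λ δ) (a δ) hexCriticalFugacity (5 / 8) e‖) ≤
          C * δ ^ (-s) * ‖hexParafermionicObservable (Λ δ) (a δ) hexCriticalFugacity (5 / 8) (b δ)‖

/-- **LOAD-BEARING for `stub_localL1Bound`: the exhaustion clause.** Already the single instance
`s = 3/4` of the exhaustion-free local `L¹` bound is FALSE (same family: `|F_{5/8}(e⋆)| = x_c^{2iK2+1}`
by uniqueness of the corridor walk, `|F_{5/8}(b_δ)| ≤ Z(b_δ) ≤ x_c^{J+1}`). -/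
theorem localL1Bound_false_without_exhaustion : ¬ LocalL1BoundWithoutExhaustion (3 / 4) := by
  intro h
  obtain ⟨C, hC⟩ := h D₀ 1 Λfam mRow aE bE one_pos D₀_flat frame_fam tendsto_aE tendsto_bE
    Kfam Kfam_compact Kfam_sub
  refine fam_violates C (5 / 8) (hC.mono fun δ hδ => ?_)
  rwa [show (-(3 / 4) : ℝ) = -(3 : ℝ) / 4 by norm_num] at hδ

/-- Hence the exhaustion-free version of the registered stub (`∀ s > 0`) is false. -/
theorem not_forall_localL1BoundWithoutExhaustion :
    ¬ ∀ s : ℝ, 0 < s → LocalL1BoundWithoutExhaustion s :=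
  fun h => localL1Bound_false_without_exhaustion (h (3 / 4) (by norm_num))

end Final

end Summit.CriticalPhenomena.SAWScalingLimit.Theorems.MassRatio.Negative.NoExhaustion
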